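import Summits.ValiantsHypothesis.ValiantsHypothesis.Theses.BorderApolarity
import Literature.Computability.AlgebraicComplexity.Apolarity
import Literature.Barriers.ValiantsHypothesis.PartialDerivativesDetPerm
import Mathlib.Algebra.MvPolynomial.PDeriv
import HarnessLib.Audit

/-!
# drefute certificate for line `cone-purity-squeeze` (crux stmt-ValiantsHypothesis-5778):
# the crux follows from the climb ALONE — stubs 1–5 proved verbatim, glue kernel-checked

`DrefuteProbe.LineReduction.fixedWitnessObstructionQP_of_climb :
   Climb (= stub_pureBorderObstruction, verbatim) → BorderApolarity.FixedWitnessObstructionQP`, sorry-free.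

Contents: Part A the cdisprover's ApolarityAPI (verbatim); then the five infrastructure stubs of
`Lines/cone-purity-squeeze.lean` proved verbatim —
`DrefuteProbe.ConePurity.stub_conePurity` (hypothesis `htor` unused),
`DrefuteProbe.stub_h0Elementary`, `DrefuteProbe.AnnDim.stub_annSubmodule`,
`DrefuteProbe.Kuratowski.stub_kuratowskiSubmodule`, `DrefuteProbe.stub_limitIdeal` —
and the skeleton's glue with `stub_pureBorderObstruction` turned into the hypothesis `Climb`.
-/


/-!
# Apolarity API (cdisprove gen 2 by-product): bilinearity, multiplicativity, GL-equivariance, derivative rule, torus facts, closedness, W5 collapse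
# and the collapse of the apolarity clause W5 to its top degree.
-/

namespace Summit.ValiantsHypothesis.ValiantsHypothesis.Cruxes.FixedWitnessObstructionQP.Disproof.Bilin

open Literature.Computability.AlgebraicComplexity
open MvPolynomial Filter
open scoped BigOperators Topology Matrix

set_option linter.dupNamespace false
set_option linter.unusedSectionVars false

noncomputable section

variable {σ : Type*} {k : Type*} [CommRing k] [DecidableEq σ]

/-- The descending-factorial coefficient `c(d,e) = ∏_{i ∈ supp e} dᵢ!/(dᵢ−eᵢ)!`. -/
def dcoef (d e : σ →₀ ℕ) : k := ∏ i ∈ e.support, (Nat.descFactorial (d i) (e i) : k)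

/-- `apolarAction` as an iterated `Finsupp.sum` over the coefficient functions. -/
theorem apolarAction_eq_sum (D f : MvPolynomial σ k) :
    apolarAction D f = (AddMonoidAlgebra.coeff D).sum (fun e a =>
      (AddMonoidAlgebra.coeff f).sum (fun d b => monomial (d - e) (a * b * dcoef d e))) :=
  rfl

/-! ## Bilinearity -/

theorem apolarAction_add_left (D E f : MvPolynomial σ k) :
    apolarAction (D + E) f = apolarAction D f + apolarAction E f := by
  rw [apolarAction_eq_sum, apolarAction_eq_sum, apolarAction_eq_sum, AddMonoidAlgebra.coeff_add]
  apply Finsupp.sum_add_index'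
  · intro e
    simp [Finsupp.sum]
  · intro e a₁ a₂
    simp only [Finsupp.sum, ← Finset.sum_add_distrib, ← map_add]
    refine Finset.sum_congr rfl fun d _ => ?_
    congr 1
    ring

theorem apolarAction_add_right (D f g : MvPolynomial σ k) :
    apolarAction D (f + g) = apolarAction D f + apolarAction D g := by
  rw [apolarAction_eq_sum, apolarAction_eq_sum, apolarAction_eq_sum, AddMonoidAlgebra.coeff_add,
    ← Finsupp.sum_add]
  refine Finsupp.sum_congr fun e _ => ?_
  apply Finsupp.sum_add_index'
  · intro d
    simp
  · intro d b₁ b₂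
    rw [← map_add]
    congr 1
    ring

theorem apolarAction_smul_left (c : k) (D f : MvPolynomial σ k) :
    apolarAction (c • D) f = c • apolarAction D f := by
  rw [apolarAction_eq_sum, apolarAction_eq_sum, AddMonoidAlgebra.coeff_smul, Finsupp.sum_smul_index']
  · simp only [Finsupp.sum, Finset.smul_sum, smul_monomial, smul_eq_mul]
    refine Finset.sum_congr rfl fun e _ => Finset.sum_congr rfl fun d _ => ?_
    congr 1
    ring
  · intro e
    simp [Finsupp.sum]

theorem apolarAction_smul_right (c : k) (D f : MvPolynomial σ k) :
    apolarAction D (c • f) = c • apolarAction D f := by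
  rw [apolarAction_eq_sum, apolarAction_eq_sum, AddMonoidAlgebra.coeff_smul, Finsupp.smul_sum]
  refine Finsupp.sum_congr fun e _ => ?_
  rw [Finsupp.sum_smul_index', Finsupp.smul_sum]
  · refine Finsupp.sum_congr fun d _ => ?_
    rw [smul_monomial, smul_eq_mul]
    congr 1
    ring
  · intro d
    simp

theorem apolarAction_sum_left {ι : Type*} (s : Finset ι) (D : ι → MvPolynomial σ k)
    (f : MvPolynomial σ k) : apolarAction (∑ i ∈ s, D i) f = ∑ i ∈ s, apolarAction (D i) f := by
  classical
  induction s using Finset.induction_on with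
  | empty => simp
  | insert a s ha ih => rw [Finset.sum_insert ha, Finset.sum_insert ha, apolarAction_add_left, ih]

theorem apolarAction_sum_right {ι : Type*} (s : Finset ι) (D : MvPolynomial σ k)
    (f : ι → MvPolynomial σ k) : apolarAction D (∑ i ∈ s, f i) = ∑ i ∈ s, apolarAction D (f i) := by
  classical
  induction s using Finset.induction_on with
  | empty => simp
  | insert a s ha ih => rw [Finset.sum_insert ha, Finset.sum_insert ha, apolarAction_add_right, ih]

theorem apolarAction_sub_left (D E f : MvPolynomial σ k) :
    apolarAction (D - E) f = apolarAction D f - apolarAction E f := by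
  rw [sub_eq_add_neg, apolarAction_add_left, ← neg_one_smul k E, apolarAction_smul_left, neg_one_smul,
    sub_eq_add_neg]

/-! ## Monomial formula and the derivative rule -/

theorem apolarAction_monomial_monomial' (e d : σ →₀ ℕ) (a b : k) :
    apolarAction (monomial e a) (monomial d b) = monomial (d - e) (a * b * dcoef d e) := by
  classical
  rw [apolarAction_monomial_monomial]
  rfl

/-- `c(d, e + eᵢ) = c(d, e) · (dᵢ − eᵢ)`, unconditionally. -/
theorem dcoef_add_single (d e : σ →₀ ℕ) (i : σ) :
    (dcoef d (e + Finsupp.single i 1) : k) = dcoef d e * ((d i - e i : ℕ) : k) := by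
  classical
  unfold dcoef
  set S := insert i e.support with hS
  have hsub1 : (e + Finsupp.single i 1).support ⊆ S := by
    intro j hj
    rw [hS, Finset.mem_insert]
    by_cases hji : j = i
    · exact Or.inl hji
    · right
      rw [Finsupp.mem_support_iff] at hj ⊢
      simpa [Finsupp.single_apply, Ne.symm hji] using hj
  have hsub2 : e.support ⊆ S := Finset.subset_insert _ _
  have h1 : ∏ j ∈ (e + Finsupp.single i 1).support,
      ((Nat.descFactorial (d j) ((e + Finsupp.single i 1 : σ →₀ ℕ) j) : ℕ) : k) =
      ∏ j ∈ S, ((Nat.descFactorial (d j) ((e + Finsupp.single i 1 : σ →₀ ℕ) j) : ℕ) : k) :=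
    Finset.prod_subset hsub1 fun j _ hj => by
      rw [Finsupp.notMem_support_iff] at hj
      rw [hj, Nat.descFactorial_zero, Nat.cast_one]
  have h2 : ∏ j ∈ e.support, ((Nat.descFactorial (d j) (e j) : ℕ) : k) =
      ∏ j ∈ S, ((Nat.descFactorial (d j) (e j) : ℕ) : k) :=
    Finset.prod_subset hsub2 fun j _ hj => by
      rw [Finsupp.notMem_support_iff] at hj
      rw [hj, Nat.descFactorial_zero, Nat.cast_one]
  have hi : i ∈ S := Finset.mem_insert_self _ _
  rw [h1, h2, ← Finset.mul_prod_erase S _ hi, ← Finset.mul_prod_erase S _ hi]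
  have h3 : ∏ j ∈ S.erase i, ((Nat.descFactorial (d j) ((e + Finsupp.single i 1 : σ →₀ ℕ) j) : ℕ) : k) =
      ∏ j ∈ S.erase i, ((Nat.descFactorial (d j) (e j) : ℕ) : k) := by
    refine Finset.prod_congr rfl fun j hj => ?_
    have hji : j ≠ i := Finset.ne_of_mem_erase hj
    simp [hji.symm]
  rw [h3]
  simp only [Finsupp.add_apply, Finsupp.single_eq_same]
  rw [Nat.descFactorial_succ]
  push_cast
  ring

/-- **Derivative rule**: `(Xᵢ · D) ⌟ f = Xᵢ ⌟ (D ⌟ f)` (i.e. `∂ᵢ ∘ D(∂) = (∂ᵢ D)(∂)`). [folklore] -/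
theorem apolarAction_X_mul (i : σ) (D f : MvPolynomial σ k) :
    apolarAction (X i * D) f = apolarAction (X i) (apolarAction D f) := by
  classical
  -- reduce to monomials by bilinearity
  conv_lhs => rw [as_sum D, as_sum f, Finset.mul_sum]
  conv_rhs => rw [as_sum D, as_sum f]
  simp only [apolarAction_sum_left, apolarAction_sum_right]
  refine Finset.sum_congr rfl fun e _ => Finset.sum_congr rfl fun d _ => ?_
  rw [X, monomial_mul, apolarAction_monomial_monomial', apolarAction_monomial_monomial',
    apolarAction_monomial_monomial', one_mul, add_comm (Finsupp.single i 1), dcoef_add_single,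
    tsub_tsub]
  congr 1
  have hc : ∀ u : σ →₀ ℕ, (dcoef u (Finsupp.single i 1) : k) = ((u i : ℕ) : k) := by
    intro u
    unfold dcoef
    rw [Finsupp.support_single _ one_ne_zero, Finset.prod_singleton, Finsupp.single_eq_same,
      Nat.descFactorial_one]
  rw [hc, Finsupp.tsub_apply]
  ring

/-- Coefficients of `Xᵢ ⌟ g` (the partial derivative): `(Xᵢ ⌟ g)_u = (uᵢ + 1) g_{u + eᵢ}`. [folklore] -/
theorem coeff_apolarAction_X (i : σ) (g : MvPolynomial σ k) (u : σ →₀ ℕ) :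
    coeff u (apolarAction (X i) g) = ((u i + 1 : ℕ) : k) * coeff (u + Finsupp.single i 1) g := by
  classical
  conv_lhs => rw [as_sum g]
  rw [apolarAction_sum_right, coeff_sum]
  simp only [X, apolarAction_monomial_monomial', one_mul, coeff_monomial]
  have hc : ∀ d : σ →₀ ℕ, (dcoef d (Finsupp.single i 1) : k) = ((d i : ℕ) : k) := by
    intro d
    unfold dcoef
    rw [Finsupp.support_single _ one_ne_zero, Finset.prod_singleton, Finsupp.single_eq_same,
      Nat.descFactorial_one]
  simp only [hc]
  rw [Finset.sum_eq_single (u + Finsupp.single i 1)]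
  · simp only [add_tsub_cancel_right, if_true, Finsupp.add_apply, Finsupp.single_eq_same]
    ring
  · intro d _ hne
    split_ifs with h
    · -- d - eᵢ = u but d ≠ u + eᵢ forces dᵢ = 0
      have hdi : d i = 0 := by
        by_contra hpos
        apply hne
        ext j
        have := congrArg (fun f : σ →₀ ℕ => f j) h
        simp only [Finsupp.tsub_apply, Finsupp.single_apply] at this
        simp only [Finsupp.add_apply, Finsupp.single_apply]
        by_cases hji : i = j
        · subst hji; simp only [if_true] at this ⊢; omega
        · simp only [if_neg hji] at this ⊢; omega
      rw [hdi, Nat.cast_zero, mul_zero]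
    · rfl
  · intro hn
    rw [if_pos (add_tsub_cancel_right _ _), notMem_support_iff.1 hn, zero_mul]

/-- A form of positive degree all of whose first partials vanish is zero (char 0). [folklore] -/
theorem eq_zero_of_forall_apolarAction_X [CharZero k] [IsDomain k] {g : MvPolynomial σ k} {j : ℕ}
    (hg : g.IsHomogeneous j) (hj : 1 ≤ j) (h : ∀ i, apolarAction (X i) g = 0) : g = 0 := by
  classical
  by_contra hne
  obtain ⟨d, hd⟩ := ne_zero_iff.1 hne
  have hdeg : d.degree = j := by
    rw [Finsupp.degree_eq_weight_one]; exact hg hd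
  obtain ⟨i, hi⟩ : ∃ i, d i ≠ 0 := by
    by_contra hcon
    push Not at hcon
    have : d = 0 := Finsupp.ext hcon
    rw [this, map_zero] at hdeg
    omega
  have key := congrArg (coeff (d - Finsupp.single i 1)) (h i)
  rw [coeff_apolarAction_X, coeff_zero] at key
  have hsub : d - Finsupp.single i 1 + Finsupp.single i 1 = d := by
    apply tsub_add_cancel_of_le
    exact Finsupp.single_le_iff.2 (Nat.one_le_iff_ne_zero.2 hi)
  rw [hsub] at key
  rcases mul_eq_zero.1 key with h1 | h2
  · exact absurd h1 (Nat.cast_ne_zero.2 (Nat.succ_ne_zero _))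
  · exact hd h2

/-- `apolarAction` of forms is a form: `deg (D ⌟ f) = deg f − deg D`. [folklore] -/
theorem apolarAction_isHomogeneous {D f : MvPolynomial σ k} {j m : ℕ} (hD : D.IsHomogeneous j)
    (hf : f.IsHomogeneous m) : (apolarAction D f).IsHomogeneous (m - j) := by
  classical
  rw [apolarAction_def]
  refine IsHomogeneous.sum _ _ _ fun e he => IsHomogeneous.sum _ _ _ fun d hd => ?_
  by_cases hle : e ≤ d
  · apply isHomogeneous_monomial
    have hedeg : e.degree = j := by
      rw [Finsupp.degree_eq_weight_one]; exact hD (mem_support_iff.1 he)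
    have hddeg : d.degree = m := by
      rw [Finsupp.degree_eq_weight_one]; exact hf (mem_support_iff.1 hd)
    have : (d - e).degree + e.degree = d.degree := by
      rw [← map_add, tsub_add_cancel_of_le hle]
    omega
  · have := apolarAction_monomial_monomial_of_not_le hle (coeff e D) (coeff d f)
    rw [apolarAction_monomial_monomial] at this
    rw [this]
    exact isHomogeneous_zero _ _ _

/-! ## Collapse of the apolarity clause W5 to its top degree -/

/-- Multiplication by `Xᵢ` is coefficientwise continuous. [folklore] -/
theorem tendsto_coeffVec_X_mul {Ds : ℕ → MvPolynomial σ ℂ} {D : MvPolynomial σ ℂ} (i : σ)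
    (h : Tendsto (fun t => coeffVec (Ds t)) atTop (𝓝 (coeffVec D))) :
    Tendsto (fun t => coeffVec (X i * Ds t)) atTop (𝓝 (coeffVec (X i * D))) := by
  classical
  rw [tendsto_pi_nhds] at h ⊢
  intro u
  simp only [coeffVec_apply, coeff_X_mul']
  split_ifs with hu
  · exact h _
  · exact tendsto_const_nhds

/-- **W5 collapses to degree `m`.** For a border-apolarity limit `J` (Li ∧ Ls up to degree `m`)
and a form `g` of degree `m`: if `J_m ⌟ g = 0` then `J_j ⌟ g = 0` for every `j ≤ m`.  Reason: `J` is
stable under `D ↦ Xᵢ·D` (limits of ideals), `(Xᵢ D) ⌟ g = ∂ᵢ(D ⌟ g)`, and a form of positive degree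
with all partials zero vanishes.  So the only apolarity information in a witness is ONE hyperplane
condition `J_m = g^⊥_m`. [folklore] -/
theorem apolar_all_of_top {m : ℕ} {P : ℕ → MvPolynomial σ ℂ} {J : ℕ → Set (MvPolynomial σ ℂ)}
    (hJ : IsBorderApolarLimit m P J) {g : MvPolynomial σ ℂ} (hg : g.IsHomogeneous m)
    (htop : ∀ D ∈ J m, apolarAction D g = 0) :
    ∀ j ≤ m, ∀ D ∈ J j, apolarAction D g = 0 := by
  classical
  suffices H : ∀ r j, j + r = m → ∀ D ∈ J j, apolarAction D g = 0 by
    intro j hj D hD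
    exact H (m - j) j (by omega) D hD
  intro r
  induction r with
  | zero =>
    intro j hj D hD
    rw [add_zero] at hj
    subst hj
    exact htop D hD
  | succ r ih =>
    intro j hj D hD
    have hjm : j ≤ m := by omega
    have hDhom : D.IsHomogeneous j := hJ.isHomogeneous_of_mem hjm hD
    have hX : ∀ i, X i * D ∈ J (j + 1) := by
      intro i
      obtain ⟨Ds, hDs, hlim⟩ := hJ.exists_tendsto hjm hD
      refine hJ.mem_of_tendsto (k := j + 1) (by omega) (φ := id) (Ds := fun t => X i * Ds t)
        strictMono_id (fun t => ⟨?_, ?_⟩) (tendsto_coeffVec_X_mul i hlim)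
      · have := (isHomogeneous_X ℂ i).mul (hDs t).1
        rwa [add_comm] at this
      · change apolarAction (X i * Ds t) (P t) = 0
        rw [apolarAction_X_mul, (hDs t).2, apolarAction_zero_right]
    have hzero : ∀ i, apolarAction (X i) (apolarAction D g) = 0 := fun i => by
      rw [← apolarAction_X_mul]
      exact ih (j + 1) (by omega) _ (hX i)
    exact eq_zero_of_forall_apolarAction_X (apolarAction_isHomogeneous hDhom hg) (by omega) hzero

/-! ## `Xᵢ ⌟ ·` is the partial derivative; multiplicativity; GL-equivariance -/

section Equivariance

variable [Fintype σ]

omit [Fintype σ] in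
/-- `C a ⌟ g = a • g`. [folklore] -/
theorem apolarAction_C (a : k) (g : MvPolynomial σ k) : apolarAction (C a) g = a • g := by
  classical
  conv_lhs => rw [as_sum g]
  rw [apolarAction_sum_right]
  conv_rhs => rw [as_sum g, Finset.smul_sum]
  refine Finset.sum_congr rfl fun d _ => ?_
  rw [← monomial_zero', apolarAction_monomial_monomial', tsub_zero, smul_monomial, smul_eq_mul]
  congr 1
  unfold dcoef
  rw [Finsupp.support_zero, Finset.prod_empty, mul_one]

omit [Fintype σ] in
/-- `Xᵢ ⌟ g = ∂g/∂xᵢ` (Mathlib's `pderiv`). [folklore] -/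
theorem apolarAction_X (i : σ) (g : MvPolynomial σ k) : apolarAction (X i) g = pderiv i g := by
  classical
  conv_lhs => rw [as_sum g]
  conv_rhs => rw [as_sum g]
  rw [apolarAction_sum_right, map_sum]
  refine Finset.sum_congr rfl fun d _ => ?_
  rw [X, apolarAction_monomial_monomial', pderiv_monomial, one_mul]
  congr 1
  unfold dcoef
  rw [Finsupp.support_single _ one_ne_zero, Finset.prod_singleton, Finsupp.single_eq_same,
    Nat.descFactorial_one]

omit [Fintype σ] in
/-- **Multiplicativity**: `(D₁ D₂) ⌟ f = D₁ ⌟ (D₂ ⌟ f)` — `f ↦ D ⌟ f` is a `k[∂]`-module structure. [folklore] -/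
theorem apolarAction_mul (D₁ D₂ f : MvPolynomial σ k) :
    apolarAction (D₁ * D₂) f = apolarAction D₁ (apolarAction D₂ f) := by
  classical
  induction D₁ using MvPolynomial.induction_on generalizing D₂ with
  | C a =>
    rw [apolarAction_C, ← smul_eq_C_mul, apolarAction_smul_left]
  | add p q hp hq =>
    rw [add_mul, apolarAction_add_left, apolarAction_add_left, hp, hq]
  | mul_X p i hp =>
    rw [mul_comm p (X i), mul_assoc, apolarAction_X_mul, hp, ← apolarAction_X_mul]

/-- Chain rule for a single partial derivative through a linear substitution:
`∂ᵢ(g ∘ Aᵀ) = Σ_j A i j · (∂ⱼ g) ∘ Aᵀ`, i.e. `Xᵢ ⌟ (A·g) = A·((Aᵀ·Xᵢ) ⌟ g)`. [folklore] -/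
theorem pderiv_linSubst (A : Matrix σ σ k) (i : σ) (g : MvPolynomial σ k) :
    pderiv i (linSubst σ k A g) = ∑ j, A i j • linSubst σ k A (pderiv j g) := by
  classical
  induction g using MvPolynomial.induction_on with
  | C c =>
    simp
  | add p q hp hq =>
    simp only [map_add, hp, hq, smul_add, Finset.sum_add_distrib]
  | mul_X p l hp =>
    have h1 : pderiv i (linSubst σ k A (X l)) = C (A i l) := by
      rw [linSubst_X, map_sum, Finset.sum_eq_single i]
      · rw [Derivation.map_smul, pderiv_X, Pi.single_eq_same, smul_eq_C_mul, mul_one]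
      · intro j _ hji
        rw [Derivation.map_smul, pderiv_X, Pi.single_eq_of_ne hji, smul_zero]
      · intro h
        exact absurd (Finset.mem_univ i) h
    have lhs : pderiv i (linSubst σ k A (p * X l)) =
        A i l • linSubst σ k A p + linSubst σ k A (X l) * pderiv i (linSubst σ k A p) := by
      rw [map_mul, Derivation.leibniz, h1, smul_eq_mul, smul_eq_mul, mul_comm (linSubst σ k A p) (C _),
        ← smul_eq_C_mul]
    have hj : ∀ j, linSubst σ k A (pderiv j (p * X l)) =
        (if l = j then linSubst σ k A p else 0) + linSubst σ k A (X l) * linSubst σ k A (pderiv j p) := by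
      intro j
      rw [Derivation.leibniz, pderiv_X, smul_eq_mul, smul_eq_mul, map_add, map_mul, map_mul]
      congr 1
      simp only [Pi.single_apply]
      split_ifs with h <;> simp
    have rhs : (∑ j, A i j • linSubst σ k A (pderiv j (p * X l))) =
        A i l • linSubst σ k A p + linSubst σ k A (X l) * ∑ j, A i j • linSubst σ k A (pderiv j p) := by
      simp only [hj, smul_add, Finset.sum_add_distrib]
      congr 1
      · simp only [smul_ite, smul_zero, Finset.sum_ite_eq, Finset.mem_univ, if_true]
      · rw [Finset.mul_sum]
        refine Finset.sum_congr rfl fun j _ => ?_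
        rw [mul_smul_comm]
    rw [lhs, rhs, hp]

/-- **GL-equivariance of apolarity**: `D ⌟ (A·f) = A·((Aᵀ·D) ⌟ f)` for every matrix `A`
(`A·f = linSubst A f = f ∘ Aᵀ`).  In particular, for invertible `A`,
`Ann(A·f) = {D : Aᵀ·D ∈ Ann f}` — the transport rule behind W4 of the crux. [folklore] -/
theorem apolarAction_linSubst (A : Matrix σ σ k) (D f : MvPolynomial σ k) :
    apolarAction D (linSubst σ k A f) = linSubst σ k A (apolarAction (linSubst σ k Aᵀ D) f) := by
  classical
  induction D using MvPolynomial.induction_on generalizing f with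
  | C a =>
    rw [linSubst_C, apolarAction_C, apolarAction_C, map_smul]
  | add p q hp hq =>
    rw [apolarAction_add_left, map_add, apolarAction_add_left, map_add, hp, hq]
  | mul_X p i hp =>
    rw [mul_comm p (X i), apolarAction_X_mul, hp, apolarAction_X, pderiv_linSubst, map_mul,
      apolarAction_mul, linSubst_X, apolarAction_sum_left, map_sum]
    refine Finset.sum_congr rfl fun j _ => ?_
    rw [apolarAction_smul_left, map_smul, apolarAction_X, Matrix.transpose_apply]

/-- Hence, for invertible `A`: `D ∈ Ann(A·f) ↔ Aᵀ·D ∈ Ann(f)`. [folklore] -/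
theorem apolarAction_linSubst_eq_zero_iff (A : Matrix σ σ k) (hA : IsUnit A.det) (D f : MvPolynomial σ k) :
    apolarAction D (linSubst σ k A f) = 0 ↔ apolarAction (linSubst σ k Aᵀ D) f = 0 := by
  rw [apolarAction_linSubst]
  constructor
  · intro h
    have hinj : Function.Injective (linSubst σ k A) := by
      intro x y hxy
      have := congrArg (linSubst σ k A⁻¹) hxy
      simp only [← AlgHom.comp_apply, ← linSubst_mul, Matrix.nonsing_inv_mul _ hA, linSubst_one,
        AlgHom.id_apply] at this
      exact this
    exact hinj (h.trans (map_zero _).symm)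
  · intro h
    rw [h, map_zero]

end Equivariance


/-! ## Torus semi-invariance of `det` and torus stability of `Ann(det)`; closedness of `Ann_k` -/

section Torus

variable {K : Type*} [Field K] {ι : Type*} [Fintype ι] [DecidableEq ι]

/-- The rank-one diagonal substitution `x_{ij} ↦ aᵢ bⱼ x_{ij}`. -/
def torusDiag (a b : ι → K) : Matrix (ι × ι) (ι × ι) K := Matrix.diagonal fun p => a p.1 * b p.2

theorem torusDiag_transpose (a b : ι → K) : (torusDiag a b)ᵀ = torusDiag a b :=
  Matrix.diagonal_transpose _

theorem linSubst_torusDiag_X (a b : ι → K) (p : ι × ι) :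
    linSubst (ι × ι) K (torusDiag a b) (X p) = (a p.1 * b p.2) • X p := by
  classical
  rw [linSubst_X, Finset.sum_eq_single p]
  · simp [torusDiag]
  · intro q _ hq
    simp [torusDiag, Matrix.diagonal_apply_ne _ hq]
  · intro h; exact absurd (Finset.mem_univ p) h

/-- **Torus semi-invariance of the determinant**: `det(aᵢ bⱼ x_{ij}) = (∏ aᵢ)(∏ bⱼ) det(x)`. [folklore] -/
theorem linSubst_torusDiag_detPoly (a b : ι → K) :
    linSubst (ι × ι) K (torusDiag a b) (detPoly ι K) = ((∏ i, a i) * ∏ j, b j) • detPoly ι K := by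
  classical
  rw [detPoly, AlgHom.map_det]
  set X' : Matrix ι ι (MvPolynomial (ι × ι) K) := Matrix.mvPolynomialX ι ι K with hX'
  have hM : (linSubst (ι × ι) K (torusDiag a b)).mapMatrix X' =
      Matrix.diagonal (fun i => C (a i)) * X' * Matrix.diagonal (fun j => C (b j)) := by
    ext i j
    rw [AlgHom.mapMatrix_apply, Matrix.map_apply, Matrix.mul_diagonal, Matrix.diagonal_mul]
    simp only [hX', Matrix.mvPolynomialX_apply, linSubst_torusDiag_X, smul_eq_C_mul, map_mul]
    ring
  rw [hM, Matrix.det_mul, Matrix.det_mul, Matrix.det_diagonal, Matrix.det_diagonal, smul_eq_C_mul,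
    map_mul, map_prod, map_prod]
  ring

theorem isUnit_det_torusDiag {a b : ι → K} (ha : ∀ i, a i ≠ 0) (hb : ∀ j, b j ≠ 0) :
    IsUnit (torusDiag a b).det := by
  rw [torusDiag, Matrix.det_diagonal, isUnit_iff_ne_zero, Finset.prod_ne_zero_iff]
  intro p _
  exact mul_ne_zero (ha _) (hb _)

/-- **Torus stability of `Ann(det)`**: if `D ⌟ det = 0` then `(T·D) ⌟ det = 0` for every rank-one
diagonal scaling `T = diag(aᵢbⱼ)` with nonzero `a, b`. [folklore] -/
theorem apolarAction_torusDiag_detPoly {D : MvPolynomial (ι × ι) K}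
    (hD : apolarAction D (detPoly ι K) = 0) {a b : ι → K} (ha : ∀ i, a i ≠ 0) (hb : ∀ j, b j ≠ 0) :
    apolarAction (linSubst (ι × ι) K (torusDiag a b) D) (detPoly ι K) = 0 := by
  have h := apolarAction_linSubst_eq_zero_iff (torusDiag a b) (isUnit_det_torusDiag ha hb) D (detPoly ι K)
  rw [torusDiag_transpose] at h
  rw [← h, linSubst_torusDiag_detPoly, apolarAction_smul_right, hD, smul_zero]

end Torus

section Closed

variable {ι : Type*} [Fintype ι] [DecidableEq ι]

/-- A sum over the support of a degree-`j` form is a sum over all degree-`j` exponents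
(values in any additive commutative monoid). -/
theorem sum_support_eq_sum_deg' {A : Type*} [AddCommMonoid A] {j : ℕ} {D : MvPolynomial ι ℂ}
    (hD : D.IsHomogeneous j) (F : (ι →₀ ℕ) → A) (hF : ∀ d, coeff d D = 0 → F d = 0)
    [Fintype {d : ι →₀ ℕ // d.degree = j}] :
    ∑ d ∈ D.support, F d = ∑ d : {d : ι →₀ ℕ // d.degree = j}, F d.1 := by
  classical
  have hsub : D.support ⊆ (Finset.univ : Finset ι).finsuppAntidiag j := by
    intro d hd
    have : d.degree = j := by
      rw [Finsupp.degree_eq_weight_one]; exact hD (mem_support_iff.1 hd)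
    simp [Finset.mem_finsuppAntidiag, Finsupp.degree_eq_sum, ← this]
  rw [Finset.sum_subset hsub (fun d _ hd => hF d (notMem_support_iff.1 hd))]
  rw [← Finset.sum_subtype ((Finset.univ : Finset ι).finsuppAntidiag j)]
  intro d
  simp [Finset.mem_finsuppAntidiag, Finsupp.degree_eq_sum]

/-- The degree-`j` exponents form a finite type (local copy). -/
instance fintypeDeg' (j : ℕ) : Fintype {d : ι →₀ ℕ // d.degree = j} :=
  Fintype.subtype ((Finset.univ : Finset ι).finsuppAntidiag j) fun d => by
    simp [Finset.mem_finsuppAntidiag, Finsupp.degree_eq_sum]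

/-- A degree-`j` form is the sum of its degree-`j` terms over the finite type of exponents. -/
theorem eq_sum_deg {j : ℕ} {D : MvPolynomial ι ℂ} (hD : D.IsHomogeneous j) :
    D = ∑ d : {d : ι →₀ ℕ // d.degree = j}, monomial d.1 (coeff d.1 D) := by
  conv_lhs => rw [as_sum D]
  exact sum_support_eq_sum_deg' hD (fun d => monomial d (coeff d D)) (fun d hd => by rw [hd, map_zero])

/-- **Coefficients of `D ⌟ f` are continuous linear in the coefficients of a degree-`j` form `D`**:
`(D ⌟ f)_u = Σ_{|e| = j} D_e · (xᵉ ⌟ f)_u`. [folklore] -/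
theorem coeff_apolarAction_eq_sum_deg {j : ℕ} {D : MvPolynomial ι ℂ} (hD : D.IsHomogeneous j)
    (f : MvPolynomial ι ℂ) (u : ι →₀ ℕ) :
    coeff u (apolarAction D f) =
      ∑ e : {e : ι →₀ ℕ // e.degree = j}, coeff e.1 D * coeff u (apolarAction (monomial e.1 1) f) := by
  conv_lhs => rw [eq_sum_deg hD]
  rw [apolarAction_sum_left, coeff_sum]
  refine Finset.sum_congr rfl fun e _ => ?_
  rw [show monomial e.1 (coeff e.1 D) = coeff e.1 D • monomial e.1 (1 : ℂ) by
    rw [smul_monomial, smul_eq_mul, mul_one], apolarAction_smul_left, coeff_smul, smul_eq_mul]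

/-- **`Ann_j(f)` is closed under coefficientwise limits**: if forms `Ds t` of degree `j` annihilate
`f` and converge coefficientwise to `D`, then `D` is a form of degree `j` annihilating `f`.
(The W3 clause for a CONSTANT sequence.) [folklore] -/
theorem mem_annihilatorOfDegree_of_tendsto {j : ℕ} {f D : MvPolynomial ι ℂ} {Ds : ℕ → MvPolynomial ι ℂ}
    (hDs : ∀ t, Ds t ∈ annihilatorOfDegree f j)
    (hlim : Tendsto (fun t => coeffVec (Ds t)) atTop (𝓝 (coeffVec D))) :
    D ∈ annihilatorOfDegree f j := by
  -- homogeneity of the limit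
  have hhom : D.IsHomogeneous j := by
    have hcoeff : ∀ u : ι →₀ ℕ, u.degree ≠ j → coeff u D = 0 := by
      intro u hu
      have h1 : Tendsto (fun t => coeffVec (Ds t) u) atTop (𝓝 (coeffVec D u)) :=
        ((continuous_apply u).tendsto _).comp hlim
      have h2 : (fun t => coeffVec (Ds t) u) = fun _ => 0 := funext fun t => (hDs t).1.coeff_eq_zero hu
      rw [h2] at h1
      exact tendsto_nhds_unique h1 tendsto_const_nhds
    intro u hu
    by_contra hne
    exact hu (hcoeff u (by rwa [Finsupp.degree_eq_weight_one]))
  refine ⟨hhom, ?_⟩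
  -- each coefficient of `D ⌟ f` is the limit of the (zero) coefficients of `Ds t ⌟ f`
  ext u
  rw [coeff_zero, coeff_apolarAction_eq_sum_deg hhom]
  have hcont : Tendsto (fun t => ∑ e : {e : ι →₀ ℕ // e.degree = j},
      coeffVec (Ds t) e.1 * coeff u (apolarAction (monomial e.1 1) f)) atTop
      (𝓝 (∑ e : {e : ι →₀ ℕ // e.degree = j}, coeffVec D e.1 * coeff u (apolarAction (monomial e.1 1) f))) :=
    tendsto_finsetSum _ fun e _ => (((continuous_apply e.1).tendsto _).comp hlim).mul tendsto_const_nhds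
  have hzero : (fun t => ∑ e : {e : ι →₀ ℕ // e.degree = j},
      coeffVec (Ds t) e.1 * coeff u (apolarAction (monomial e.1 1) f)) = fun _ => 0 := by
    funext t
    have := congrArg (coeff u) (hDs t).2
    rw [coeff_apolarAction_eq_sum_deg (hDs t).1, coeff_zero] at this
    exact this
  rw [hzero] at hcont
  have := tendsto_nhds_unique tendsto_const_nhds hcont
  simpa only [coeffVec_apply] using this.symm

end Closed

end

end Summit.ValiantsHypothesis.ValiantsHypothesis.Cruxes.FixedWitnessObstructionQP.Disproof.Bilin

open MvPolynomial
open scoped BigOperators Matrix Polynomial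
open Literature.Computability.AlgebraicComplexity

namespace DrefuteProbe.ConePurity

set_option linter.unusedSectionVars false

noncomputable section

/-! ### 1. Polynomial curves inside a subspace -/

/-- If `∑_{j ∈ s} t^j • w j ∈ J` for every `t : ℂ`, then every coefficient `w j`, `j ∈ s`, lies in `J`. -/
theorem mem_of_forall_sum_pow_smul_mem {V : Type*} [AddCommGroup V] [Module ℂ V]
    (J : Submodule ℂ V) (s : Finset ℕ) (w : ℕ → V)
    (h : ∀ t : ℂ, ∑ j ∈ s, t ^ j • w j ∈ J) : ∀ j ∈ s, w j ∈ J := by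
  classical
  intro j hj
  by_contra hw
  obtain ⟨φ, hφw, hφJ⟩ := J.exists_dual_map_eq_bot_of_notMem hw inferInstance
  have hφJ' : ∀ v ∈ J, φ v = 0 := by
    intro v hv
    have : φ v ∈ J.map φ := Submodule.mem_map_of_mem hv
    rw [hφJ] at this
    simpa using this
  set q : Polynomial ℂ := ∑ i ∈ s, Polynomial.monomial i (φ (w i)) with hq
  have hq_eval : ∀ t : ℂ, q.eval t = 0 := by
    intro t
    have h1 : ∑ i ∈ s, φ (w i) * t ^ i = φ (∑ i ∈ s, t ^ i • w i) := by
      rw [map_sum]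
      refine Finset.sum_congr rfl fun i _ => ?_
      rw [map_smul, smul_eq_mul, mul_comm]
    rw [hq, Polynomial.eval_finsetSum]
    simp only [Polynomial.eval_monomial]
    rw [h1]
    exact hφJ' _ (h t)
  have hq0 : q = 0 := by
    apply Polynomial.eq_zero_of_infinite_isRoot
    have : {x | q.IsRoot x} = Set.univ := Set.eq_univ_of_forall fun x => hq_eval x
    rw [this]
    exact Set.infinite_univ
  have hcoeff : q.coeff j = φ (w j) := by
    rw [hq, Polynomial.finsetSum_coeff]
    simp only [Polynomial.coeff_monomial]
    rw [Finset.sum_ite_eq' s j (fun i => φ (w i)), if_pos hj]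
  rw [hq0, Polynomial.coeff_zero] at hcoeff
  exact hφw hcoeff.symm

/-! ### 2. The transvection curve `t ↦ linSubst (1 + t • single z y 1) D` -/

variable {σ : Type*} [Fintype σ] [DecidableEq σ]

/-- `curve y z : 𝕊 →ₐ[ℂ] 𝕊[T]`, `X y ↦ C (X y) + T·C (X z)`, `X i ↦ C (X i)` (`i ≠ y`). -/
def curve (y z : σ) : MvPolynomial σ ℂ →ₐ[ℂ] Polynomial (MvPolynomial σ ℂ) :=
  aeval fun i => if i = y then Polynomial.C (X y) + Polynomial.X * Polynomial.C (X z)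
    else Polynomial.C (X i)

theorem curve_X (y z i : σ) :
    curve y z (X i) = if i = y then Polynomial.C (X y) + Polynomial.X * Polynomial.C (X z)
      else Polynomial.C (X i) := by
  simp [curve]

theorem linSubst_transv_X (y z : σ) (c : ℂ) (i : σ) :
    linSubst σ ℂ (1 + c • Matrix.single z y (1 : ℂ)) (X i) =
      X i + (if i = y then c • X z else 0) := by
  rw [linSubst_X]
  simp only [Matrix.add_apply, Matrix.one_apply, Matrix.smul_apply, Matrix.single_apply, smul_eq_mul,
    add_smul, Finset.sum_add_distrib, ite_smul, one_smul, zero_smul, Finset.sum_ite_eq',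
    Finset.mem_univ, if_true, mul_ite, mul_one, mul_zero]
  congr 1
  by_cases hi : i = y
  · subst hi
    simp only [and_true, if_true]
    rw [Finset.sum_ite_eq Finset.univ z (fun j => c • X j), if_pos (Finset.mem_univ _)]
  · have hy : ¬ y = i := fun h => hi h.symm
    simp [hy, hi]

theorem eval_curve (y z : σ) (c : ℂ) (D : MvPolynomial σ ℂ) :
    (curve y z D).eval (C c) = linSubst σ ℂ (1 + c • Matrix.single z y (1 : ℂ)) D := by
  have key : ∀ D : MvPolynomial σ ℂ, (curve y z D).eval (C c) =
      linSubst σ ℂ (1 + c • Matrix.single z y (1 : ℂ)) D := by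
    intro D
    induction D using MvPolynomial.induction_on with
    | C a =>
      rw [linSubst_C]
      simp [curve]
    | add p q hp hq => rw [map_add, Polynomial.eval_add, hp, hq, map_add]
    | mul_X p i hp =>
      rw [map_mul, Polynomial.eval_mul, hp, map_mul, curve_X, linSubst_transv_X]
      congr 1
      split_ifs with hi
      · subst hi
        simp only [Polynomial.eval_add, Polynomial.eval_mul, Polynomial.eval_C, Polynomial.eval_X,
          smul_eq_C_mul]
      · simp
  exact key D

theorem coeff_curve_zero (y z : σ) (D : MvPolynomial σ ℂ) : (curve y z D).coeff 0 = D := by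
  rw [Polynomial.coeff_zero_eq_eval_zero, ← C_0, eval_curve, zero_smul, add_zero, linSubst_one]
  rfl

theorem coeff_curve_X_zero (y z i : σ) : (curve y z (X i)).coeff 0 = X i := by
  rw [coeff_curve_zero]

theorem coeff_curve_X_one (y z i : σ) :
    (curve y z (X i)).coeff 1 = if i = y then X z else 0 := by
  rw [curve_X]
  split_ifs with hi
  · simp [Polynomial.coeff_add, Polynomial.coeff_C]
  · simp

/-- The linear coefficient of the curve is the derivation `X z · ∂/∂X y`. -/
theorem coeff_curve_one (y z : σ) (D : MvPolynomial σ ℂ) :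
    (curve y z D).coeff 1 = X z * pderiv y D := by
  induction D using MvPolynomial.induction_on with
  | C a => simp [curve]
  | add p q hp hq => rw [map_add, Polynomial.coeff_add, hp, hq, map_add, mul_add]
  | mul_X p i hp =>
    rw [map_mul, Polynomial.coeff_mul, Finset.Nat.sum_antidiagonal_succ, Finset.Nat.antidiagonal_zero,
      Finset.sum_singleton]
    simp only [zero_add]
    rw [coeff_curve_zero, coeff_curve_X_one, hp, coeff_curve_X_zero, pderiv_mul, pderiv_X]
    simp only [Pi.single_apply]
    split_ifs with hi
    · subst hi; ring
    · ring

/-- **δ-stability.** A subspace stable under all `linSubst (1 + c • single z y 1)` is stable under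
`D ↦ X z * ∂D/∂X y`. -/
theorem delta_mem (J : Submodule ℂ (MvPolynomial σ ℂ)) (y z : σ)
    (hstab : ∀ c : ℂ, ∀ D ∈ J, linSubst σ ℂ (1 + c • Matrix.single z y (1 : ℂ)) D ∈ J)
    {D : MvPolynomial σ ℂ} (hD : D ∈ J) : X z * pderiv y D ∈ J := by
  classical
  set P := curve y z D with hP
  have hcurve : ∀ t : ℂ, ∑ j ∈ P.support, t ^ j • P.coeff j ∈ J := by
    intro t
    have h1 : P.eval (C t) = ∑ j ∈ P.support, t ^ j • P.coeff j := by
      rw [Polynomial.eval_eq_sum, Polynomial.sum_def]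
      refine Finset.sum_congr rfl fun j _ => ?_
      rw [smul_eq_C_mul, map_pow, mul_comm]
    rw [← h1, hP, eval_curve]
    exact hstab t D hD
  rw [← coeff_curve_one, ← hP]
  by_cases h1 : (1 : ℕ) ∈ P.support
  · exact mem_of_forall_sum_pow_smul_mem J P.support (fun j => P.coeff j) hcurve 1 h1
  · rw [Polynomial.notMem_support_iff.mp h1]
    exact J.zero_mem

end

end DrefuteProbe.ConePurity


/-! ## Part B2: iteration, top pairing, counting, and the stub -/

namespace DrefuteProbe.ConePurity

open Summit.ValiantsHypothesis.ValiantsHypothesis.Cruxes.FixedWitnessObstructionQP.Disproof.Bilin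

set_option linter.unusedSectionVars false

noncomputable section

section Lists

variable {σ : Type*} [Fintype σ] [DecidableEq σ]

/-! ### 3. Iterating the derivations along lists -/

theorem pderiv_prod_map_X_eq_zero (y : σ) (zs : List σ) (h : ∀ w ∈ zs, w ≠ y) :
    pderiv y ((zs.map X).prod : MvPolynomial σ ℂ) = 0 := by
  induction zs with
  | nil => simp
  | cons w zs ih =>
    rw [List.map_cons, List.prod_cons, pderiv_mul,
      ih (fun v hv => h v (List.mem_cons_of_mem _ hv)),
      pderiv_X_of_ne (h w List.mem_cons_self), zero_mul, mul_zero, add_zero]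

theorem apolarAction_one' (g : MvPolynomial σ ℂ) : apolarAction (1 : MvPolynomial σ ℂ) g = g := by
  rw [← C_1, apolarAction_C, one_smul]

/-- Iterated δ's: `X^{zs} · (X^{ys} ⌟ D) ∈ J` whenever `ys` are own, `zs` unused, same length. -/
theorem iter_mem (J : Submodule ℂ (MvPolynomial σ ℂ)) (own : σ → Prop)
    (hδ : ∀ y z, own y → ¬ own z → ∀ D ∈ J, X z * pderiv y D ∈ J) :
    ∀ (ys zs : List σ), ys.length = zs.length → (∀ y ∈ ys, own y) → (∀ z ∈ zs, ¬ own z) →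
      ∀ D ∈ J, (zs.map X).prod * apolarAction (ys.map X).prod D ∈ J := by
  intro ys
  induction ys with
  | nil =>
    intro zs hlen _ _ D hD
    cases zs with
    | nil => simpa [apolarAction_one'] using hD
    | cons z zs => simp at hlen
  | cons y ys ih =>
    intro zs hlen hys hzs D hD
    cases zs with
    | nil => simp at hlen
    | cons z zs =>
      simp only [List.length_cons, Nat.add_right_cancel_iff] at hlen
      have hy : own y := hys y List.mem_cons_self
      have hz : ¬ own z := hzs z List.mem_cons_self
      have hG := ih zs hlen (fun w hw => hys w (List.mem_cons_of_mem _ hw))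
        (fun w hw => hzs w (List.mem_cons_of_mem _ hw)) D hD
      have hne : ∀ w ∈ zs, w ≠ y := by
        intro w hw hwy
        exact hzs w (List.mem_cons_of_mem _ hw) (hwy ▸ hy)
      have h := hδ y z hy hz _ hG
      rw [pderiv_mul, pderiv_prod_map_X_eq_zero y zs hne, zero_mul, zero_add, ← apolarAction_X,
        ← apolarAction_mul] at h
      simpa only [List.map_cons, List.prod_cons, mul_assoc] using h

/-! ### 4. Top-degree pairing (from Disproof §7, verbatim) -/

/-- `d! := ∏_{i ∈ supp d} (d i)!` as a complex number. -/
def fact (d : σ →₀ ℕ) : ℂ := ∏ i ∈ d.support, ((d i).factorial : ℂ)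

theorem fact_ne_zero (d : σ →₀ ℕ) : fact d ≠ 0 := by
  unfold fact
  rw [Finset.prod_ne_zero_iff]
  intro i _
  exact_mod_cast (d i).factorial_ne_zero

theorem eq_of_le_of_degree_eq {e d : σ →₀ ℕ} (h : e ≤ d) (hdeg : e.degree = d.degree) : e = d := by
  have h1 : e + (d - e) = d := add_tsub_cancel_of_le h
  have h2 : (d - e).degree = 0 := by
    have := congrArg Finsupp.degree h1
    rw [map_add] at this
    omega
  rw [Finsupp.degree_eq_zero_iff] at h2
  rw [h2, add_zero] at h1
  exact h1

theorem apolarAction_eq_C {D g : MvPolynomial σ ℂ} {m : ℕ}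
    (hD : D.IsHomogeneous m) (hg : g.IsHomogeneous m) :
    apolarAction D g = C (∑ d ∈ D.support, coeff d D * coeff d g * fact d) := by
  classical
  rw [apolarAction_def, map_sum]
  refine Finset.sum_congr rfl fun e he => ?_
  have hedeg : e.degree = m := by
    rw [Finsupp.degree_eq_weight_one]; exact hD (mem_support_iff.1 he)
  rw [Finset.sum_eq_single e]
  · have hprod : (∏ i ∈ e.support, (Nat.descFactorial (e i) (e i) : ℂ)) = fact e := by
      unfold fact
      refine Finset.prod_congr rfl fun i _ => ?_
      rw [Nat.descFactorial_self]
    rw [tsub_self, hprod]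
    rfl
  · intro d hd hne
    have hddeg : d.degree = m := by
      rw [Finsupp.degree_eq_weight_one]; exact hg (mem_support_iff.1 hd)
    have hnle : ¬ e ≤ d := fun hle => hne (eq_of_le_of_degree_eq hle (hedeg.trans hddeg.symm)).symm
    obtain ⟨i, hi⟩ : ∃ i, d i < e i := by
      by_contra hcon
      push Not at hcon
      exact hnle fun i => hcon i
    have hie : i ∈ e.support := by
      rw [Finsupp.mem_support_iff]; omega
    have hzero : (Nat.descFactorial (d i) (e i) : ℂ) = 0 := by
      rw [Nat.descFactorial_eq_zero_iff_lt.2 hi, Nat.cast_zero]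
    rw [Finset.prod_eq_zero hie hzero, mul_zero, map_zero]
  · intro hne
    rw [notMem_support_iff] at hne
    rw [hne, mul_zero, zero_mul, map_zero]

theorem apolar_monomial_support {D : MvPolynomial σ ℂ} {k : ℕ} (hD : D.IsHomogeneous k)
    {f : σ →₀ ℕ} (hf : f ∈ D.support) :
    apolarAction (monomial f (1 : ℂ)) D = C (coeff f D * fact f) := by
  classical
  have hdeg : f.degree = k := by
    rw [Finsupp.degree_eq_weight_one]; exact hD (mem_support_iff.mp hf)
  rw [apolarAction_eq_C (isHomogeneous_monomial (1 : ℂ) hdeg) hD, support_monomial, if_neg one_ne_zero,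
    Finset.sum_singleton, coeff_monomial, if_pos rfl, one_mul]

/-! ### 5. Products of variables along lists are monomials -/

/-- Exponent of a list of variables. -/
def lsum (l : List σ) : σ →₀ ℕ := (l.map fun i => Finsupp.single i 1).sum

theorem lsum_nil : lsum ([] : List σ) = 0 := rfl

theorem lsum_cons (a : σ) (l : List σ) : lsum (a :: l) = Finsupp.single a 1 + lsum l := by
  simp [lsum]

theorem prod_map_X (l : List σ) : ((l.map X).prod : MvPolynomial σ ℂ) = monomial (lsum l) 1 := by
  induction l with
  | nil => simp [lsum_nil]
  | cons a l ih =>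
    rw [List.map_cons, List.prod_cons, ih, lsum_cons, X, monomial_mul, one_mul]

theorem lsum_coe (l : List σ) : lsum l = Multiset.toFinsupp (l : Multiset σ) := by
  induction l with
  | nil => simp [lsum_nil]
  | cons a l ih =>
    rw [lsum_cons, ih, ← Multiset.cons_coe, ← Multiset.singleton_add, Multiset.toFinsupp_add,
      Multiset.toFinsupp_singleton]

theorem lsum_toList (T : Multiset σ) : lsum T.toList = Multiset.toFinsupp T := by
  rw [lsum_coe, Multiset.coe_toList]

theorem lsum_toList_toMultiset (f : σ →₀ ℕ) : lsum (Finsupp.toMultiset f).toList = f := by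
  rw [lsum_toList, Finsupp.toMultiset_toFinsupp]

end Lists

/-! ### 6. Counting the unused variables -/

/-- The crux's "own variable" predicate (ℓ = (0,0) and the Y-block). -/
def Own (n m : ℕ) [NeZero m] (p : Fin m × Fin m) : Prop :=
  (m - n ≤ (p.1 : ℕ) ∧ m - n ≤ (p.2 : ℕ)) ∨ p = (0, 0)

instance (n m : ℕ) [NeZero m] : DecidablePred (Own n m) := fun p => by
  unfold Own; infer_instance

theorem card_unused (n m : ℕ) [NeZero m] (hnm : n < m) :
    Fintype.card {p : Fin m × Fin m // ¬ Own n m p} = m * m - (n * n + 1) := by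
  classical
  rw [Fintype.card_subtype_compl, Fintype.card_prod, Fintype.card_fin, Fintype.card_subtype]
  congr 1
  have hsplit : (Finset.univ.filter (Own n m)) =
      (Finset.univ.filter fun p : Fin m × Fin m => m - n ≤ (p.1 : ℕ) ∧ m - n ≤ (p.2 : ℕ)) ∪
        (Finset.univ.filter fun p : Fin m × Fin m => p = (0, 0)) := by
    rw [← Finset.filter_or]
    rfl
  rw [hsplit, Finset.card_union_of_disjoint]
  · have hb : (Finset.univ.filter fun i : Fin m => m - n ≤ (i : ℕ)).card = n := by
      rw [← Fintype.card_subtype]; exact card_blockIdx hnm.le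
    rw [Finset.filter_eq' Finset.univ, if_pos (Finset.mem_univ _), Finset.card_singleton,
      ← Finset.univ_product_univ, Finset.filter_product (fun i : Fin m => m - n ≤ (i : ℕ))
      (fun i : Fin m => m - n ≤ (i : ℕ)), Finset.card_product, hb]
  · rw [Finset.disjoint_left]
    intro p hp hp0
    rw [Finset.mem_filter] at hp hp0
    obtain ⟨-, rfl⟩ := hp0
    have := hp.2.1
    simp at this
    omega

/-! ### 7. The stub, verbatim -/

/-- **Stub 1 of `cone-purity-squeeze`, verbatim** (the hypothesis `htor` is not used). -/
theorem stub_conePurity (n m k : ℕ) [NeZero m]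
    (J : Submodule ℂ (MvPolynomial (Fin m × Fin m) ℂ))
    (hhom : ∀ D ∈ J, D.IsHomogeneous k)
    (hzif : ∀ y z : Fin m × Fin m,
      ((m - n ≤ (y.1 : ℕ) ∧ m - n ≤ (y.2 : ℕ)) ∨ y = (0, 0)) →
      ¬ ((m - n ≤ (z.1 : ℕ) ∧ m - n ≤ (z.2 : ℕ)) ∨ z = (0, 0)) →
      ∀ c : ℂ, ∀ D ∈ J, linSubst (Fin m × Fin m) ℂ (1 + c • Matrix.single z y (1 : ℂ)) D ∈ J)
    (htor : ∀ z : Fin m × Fin m,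
      ¬ ((m - n ≤ (z.1 : ℕ) ∧ m - n ≤ (z.2 : ℕ)) ∨ z = (0, 0)) →
      ∀ d : ℂ, d ≠ 0 → ∀ D ∈ J, linSubst (Fin m × Fin m) ℂ (Matrix.diagonal (Function.update 1 z d)) D ∈ J)
    (hdim : Module.finrank ℂ J = Nat.choose (m * m + k - 1) k - (Nat.choose m k) ^ 2)
    (hbudget : Nat.choose (m * m + k - 1) k < Nat.choose (m * m - n * n - 2 + k) k + (Nat.choose m k) ^ 2) :
    ∀ D ∈ J, (∀ s ∈ D.support, ∀ v : Fin m × Fin m,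
      ¬ ((m - n ≤ (v.1 : ℕ) ∧ m - n ≤ (v.2 : ℕ)) ∨ v = (0, 0)) → s v = 0) → D = 0 := by
  classical
  intro D hD hzfree
  -- `J` is finite-dimensional (it sits in the degree-`k` part)
  haveI : FiniteDimensional ℂ J := by
    apply Submodule.finiteDimensional_of_le (S₂ := restrictTotalDegree (Fin m × Fin m) ℂ k)
    intro E hE
    rw [mem_restrictTotalDegree]
    exact (hhom E hE).totalDegree_le
  by_contra hD0
  by_cases hmain : n < m ∧ 2 ≤ m
  · obtain ⟨hnm, hm2⟩ := hmain
    -- δ-stability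
    have hδ : ∀ y z, Own n m y → ¬ Own n m z → ∀ E ∈ J, X z * pderiv y E ∈ J :=
      fun y z hy hz E hE => delta_mem J y z (hzif y z hy hz) hE
    -- a monomial of `D`, own-supported, of degree `k`
    obtain ⟨f, hf⟩ : D.support.Nonempty := by
      rw [Finset.nonempty_iff_ne_empty, Ne, support_eq_empty]
      exact hD0
    have hfdeg : f.degree = k := by
      rw [Finsupp.degree_eq_weight_one]; exact hhom D hD (mem_support_iff.mp hf)
    have hfown : ∀ y ∈ f.support, Own n m y := by
      intro y hy
      by_contra hyo
      exact (Finsupp.mem_support_iff.mp hy) (hzfree f hf y hyo)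
    set ys := (Finsupp.toMultiset f).toList with hys
    have hys_len : ys.length = k := by
      rw [hys, Multiset.length_toList, Finsupp.card_toMultiset, ← hfdeg]
      rfl
    have hys_own : ∀ y ∈ ys, Own n m y := by
      intro y hy
      rw [hys, Multiset.mem_toList, Finsupp.mem_toMultiset] at hy
      exact hfown y hy
    have hconst : apolarAction (ys.map X).prod D = C (coeff f D * fact f) := by
      rw [prod_map_X, hys, lsum_toList_toMultiset]
      exact apolar_monomial_support (hhom D hD) hf
    have hcne : coeff f D * fact f ≠ 0 := mul_ne_zero (mem_support_iff.mp hf) (fact_ne_zero f)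
    -- every unused monomial of degree `k` lies in `J`
    have hmem : ∀ s : Sym {p : Fin m × Fin m // ¬ Own n m p} k,
        monomial (Multiset.toFinsupp ((s : Multiset {p : Fin m × Fin m // ¬ Own n m p}).map Subtype.val))
          (1 : ℂ) ∈ J := by
      intro s
      set zs := ((s : Multiset {p : Fin m × Fin m // ¬ Own n m p}).map Subtype.val).toList with hzs
      have hzs_len : ys.length = zs.length := by
        rw [hys_len, hzs, Multiset.length_toList, Multiset.card_map, Sym.card_coe]
      have hzs_un : ∀ z ∈ zs, ¬ Own n m z := by
        intro z hz
        rw [hzs, Multiset.mem_toList, Multiset.mem_map] at hz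
        obtain ⟨w, _, rfl⟩ := hz
        exact w.2
      have h := iter_mem J (Own n m) hδ ys zs hzs_len hys_own hzs_un D hD
      rw [hconst, prod_map_X, hzs, lsum_toList, mul_comm _ (C _), C_mul'] at h
      have h2 := J.smul_mem (coeff f D * fact f)⁻¹ h
      rwa [inv_smul_smul₀ hcne] at h2
    -- they are linearly independent
    set idx : Sym {p : Fin m × Fin m // ¬ Own n m p} k → ((Fin m × Fin m) →₀ ℕ) :=
      fun s => Multiset.toFinsupp ((s : Multiset {p : Fin m × Fin m // ¬ Own n m p}).map Subtype.val)
      with hidx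
    have hidx_inj : Function.Injective idx := by
      intro s t hst
      apply Sym.coe_injective
      apply Multiset.map_injective Subtype.val_injective
      exact Multiset.toFinsupp.injective hst
    have hli : LinearIndependent ℂ (fun s => (⟨monomial (idx s) 1, hmem s⟩ : J)) := by
      apply LinearIndependent.of_comp J.subtype
      have hcomp : (J.subtype ∘ fun s => (⟨monomial (idx s) 1, hmem s⟩ : J)) =
          (basisMonomials (Fin m × Fin m) ℂ) ∘ idx := by
        funext s
        simp only [Function.comp_apply, Submodule.subtype_apply, coe_basisMonomials]
      rw [hcomp]
      exact (basisMonomials (Fin m × Fin m) ℂ).linearIndependent.comp idx hidx_inj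
    have hcard_le := hli.fintype_card_le_finrank
    rw [Sym.card_sym_eq_choose, card_unused n m hnm] at hcard_le
    -- arithmetic
    have hMN : n * n + 2 ≤ m * m := by
      rcases Nat.eq_zero_or_pos n with rfl | hn
      · nlinarith [Nat.mul_le_mul hm2 hm2]
      · nlinarith [Nat.mul_le_mul hnm hnm]
    have e : m * m - (n * n + 1) + k - 1 = m * m - n * n - 2 + k := by omega
    rw [e] at hcard_le
    have hB : 1 ≤ Nat.choose (m * m - n * n - 2 + k) k := Nat.choose_pos (by omega)
    omega
  · -- degenerate regimes: no unused variables, `hbudget` forces `J = ⊥`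
    have e : m * m - n * n - 2 + k = k := by
      rcases Nat.lt_or_ge n m with h | h
      · have hm1 : m = 1 := by
          have := NeZero.ne m
          omega
        subst hm1
        omega
      · have : m * m ≤ n * n := Nat.mul_le_mul h h
        omega
    rw [e, Nat.choose_self] at hbudget
    have h0 : Module.finrank ℂ J = 0 := by rw [hdim]; omega
    rw [Submodule.finrank_eq_zero] at h0
    rw [h0, Submodule.mem_bot] at hD
    exact hD0 hD

end

end DrefuteProbe.ConePurity


open MvPolynomial Filter Topology
open scoped BigOperators
open Literature.Computability.AlgebraicComplexity

namespace DrefuteProbe.Kuratowski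

set_option linter.unusedSectionVars false

noncomputable section

section Coord

variable {σ : Type} [Fintype σ] [DecidableEq σ]

/-- Degree-`k` exponents, as a finset. -/
def degF (σ : Type) [Fintype σ] [DecidableEq σ] (k : ℕ) : Finset (σ →₀ ℕ) :=
  (Finset.univ : Finset σ).finsuppAntidiag k

theorem mem_degF {k : ℕ} {u : σ →₀ ℕ} : u ∈ degF σ k ↔ u.degree = k := by
  rw [degF, Finset.mem_finsuppAntidiag, Finsupp.degree_eq_sum]
  simp

/-- Restriction of the coefficient vector to degree `k`. -/
def T (k : ℕ) : MvPolynomial σ ℂ →ₗ[ℂ] (degF σ k → ℂ) where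
  toFun p := fun u => coeff u.1 p
  map_add' p q := by funext u; simp
  map_smul' c p := by funext u; simp

theorem T_apply (k : ℕ) (p : MvPolynomial σ ℂ) (u : degF σ k) : T k p u = coeff u.1 p := rfl

/-- The degree-`k` form with prescribed degree-`k` coefficients. -/
def S (k : ℕ) (v : degF σ k → ℂ) : MvPolynomial σ ℂ := ∑ u : degF σ k, monomial u.1 (v u)

theorem coeff_S (k : ℕ) (v : degF σ k → ℂ) (w : σ →₀ ℕ) :
    coeff w (S k v) = if h : w ∈ degF σ k then v ⟨w, h⟩ else 0 := by
  rw [S, coeff_sum]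
  simp only [coeff_monomial]
  split_ifs with h
  · rw [Finset.sum_eq_single ⟨w, h⟩]
    · simp
    · intro u _ hu
      rw [if_neg]
      intro heq
      exact hu (Subtype.ext heq)
    · intro hu
      exact absurd (Finset.mem_univ _) hu
  · apply Finset.sum_eq_zero
    intro u _
    rw [if_neg]
    intro heq
    exact h (heq ▸ u.2)

theorem isHomogeneous_S (k : ℕ) (v : degF σ k → ℂ) : (S k v).IsHomogeneous k := by
  unfold S
  apply IsHomogeneous.sum
  intro u _
  exact isHomogeneous_monomial _ (mem_degF.mp u.2)

theorem T_S (k : ℕ) (v : degF σ k → ℂ) : T k (S k v) = v := by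
  funext u
  rw [T_apply, coeff_S, dif_pos u.2]

theorem S_T (k : ℕ) {p : MvPolynomial σ ℂ} (hp : p.IsHomogeneous k) : S k (T k p) = p := by
  ext w
  rw [coeff_S]
  split_ifs with h
  · rfl
  · exact (hp.coeff_eq_zero (fun hw => h (mem_degF.mpr hw))).symm

theorem eq_of_T_eq (k : ℕ) {p q : MvPolynomial σ ℂ} (hp : p.IsHomogeneous k) (hq : q.IsHomogeneous k)
    (h : T k p = T k q) : p = q := by
  rw [← S_T k hp, ← S_T k hq, h]

theorem T_eq_zero_iff (k : ℕ) {p : MvPolynomial σ ℂ} (hp : p.IsHomogeneous k) : T k p = 0 ↔ p = 0 :=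
  ⟨fun h => eq_of_T_eq k hp (isHomogeneous_zero σ ℂ k) (by rw [h, map_zero]),
    fun h => by rw [h, map_zero]⟩

/-- Coefficientwise convergence of degree-`k` forms = convergence of the degree-`k` coordinates. -/
theorem tendsto_T_iff (k : ℕ) {x : ℕ → MvPolynomial σ ℂ} {p : MvPolynomial σ ℂ}
    (hx : ∀ t, (x t).IsHomogeneous k) (hp : p.IsHomogeneous k) :
    Tendsto (fun t => coeffVec (x t)) atTop (𝓝 (coeffVec p)) ↔
      Tendsto (fun t => T k (x t)) atTop (𝓝 (T k p)) := by
  rw [tendsto_pi_nhds, tendsto_pi_nhds]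
  constructor
  · intro h u
    exact h u.1
  · intro h w
    by_cases hw : w.degree = k
    · exact h ⟨w, mem_degF.mpr hw⟩
    · have h1 : (fun t => coeffVec (x t) w) = fun _ => (0 : ℂ) :=
        funext fun t => (hx t).coeff_eq_zero hw
      have h2 : coeffVec p w = 0 := hp.coeff_eq_zero hw
      rw [h1, h2]
      exact tendsto_const_nhds

end Coord

/-- **Stub 4 of `cone-purity-squeeze`, verbatim.** -/
theorem stub_kuratowskiSubmodule {σ : Type} [Fintype σ] (k d : ℕ)
    (A : ℕ → Submodule ℂ (MvPolynomial σ ℂ)) (L : Set (MvPolynomial σ ℂ))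
    (hA : ∀ t, A t ≤ MvPolynomial.homogeneousSubmodule σ ℂ k)
    (hd : ∀ t, Module.finrank ℂ (A t) = d)
    (hLi : ∀ D ∈ L, ∃ Ds : ℕ → MvPolynomial σ ℂ, (∀ t, Ds t ∈ A t) ∧
      Tendsto (fun t => coeffVec (Ds t)) atTop (nhds (coeffVec D)))
    (hLs : ∀ (D : MvPolynomial σ ℂ) (φ : ℕ → ℕ) (Ds : ℕ → MvPolynomial σ ℂ), StrictMono φ →
      (∀ t, Ds t ∈ A (φ t)) → Tendsto (fun t => coeffVec (Ds t)) atTop (nhds (coeffVec D)) → D ∈ L) :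
    ∃ Lk : Submodule ℂ (MvPolynomial σ ℂ), (Lk : Set (MvPolynomial σ ℂ)) = L ∧
      Lk ≤ MvPolynomial.homogeneousSubmodule σ ℂ k ∧ Module.finrank ℂ Lk = d := by
  classical
  -- the ambient finite-dimensional space of degree-`k` forms
  haveI hVfin : FiniteDimensional ℂ (homogeneousSubmodule σ ℂ k) := by
    apply Submodule.finiteDimensional_of_le (S₂ := restrictTotalDegree σ ℂ k)
    intro E hE
    rw [mem_restrictTotalDegree]
    exact ((mem_homogeneousSubmodule k E).mp hE).totalDegree_le
  haveI hAfin : ∀ t, FiniteDimensional ℂ (A t) := fun t => Submodule.finiteDimensional_of_le (hA t)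
  have hAhom : ∀ t, ∀ p ∈ A t, p.IsHomogeneous k := fun t p hp =>
    (mem_homogeneousSubmodule k p).mp (hA t hp)
  -- Step 1: `L` consists of degree-`k` forms
  have hLhom : ∀ D ∈ L, D.IsHomogeneous k := by
    intro D hD
    obtain ⟨Ds, hDs, hlim⟩ := hLi D hD
    intro w hw
    by_contra hne
    apply hw
    have h1 : Tendsto (fun t => coeffVec (Ds t) w) atTop (𝓝 (coeffVec D w)) :=
      ((continuous_apply w).tendsto _).comp hlim
    have h2 : (fun t => coeffVec (Ds t) w) = fun _ => (0 : ℂ) :=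
      funext fun t => (hAhom t _ (hDs t)).coeff_eq_zero (d := w)
        (by rw [Finsupp.degree_eq_weight_one]; exact hne)
    rw [h2] at h1
    exact tendsto_nhds_unique h1 tendsto_const_nhds
  -- Step 2: `L` is a subspace
  have hL0 : (0 : MvPolynomial σ ℂ) ∈ L :=
    hLs 0 id (fun _ => 0) strictMono_id (fun t => (A t).zero_mem) tendsto_const_nhds
  have hcoeffVec_add : ∀ p q : MvPolynomial σ ℂ, coeffVec (p + q) = coeffVec p + coeffVec q :=
    fun p q => funext fun w => coeff_add w p q
  have hcoeffVec_smul : ∀ (c : ℂ) (p : MvPolynomial σ ℂ), coeffVec (c • p) = c • coeffVec p :=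
    fun c p => funext fun w => by simp [coeffVec]
  have hLadd : ∀ p ∈ L, ∀ q ∈ L, p + q ∈ L := by
    intro p hp q hq
    obtain ⟨Ps, hPs, hPl⟩ := hLi p hp
    obtain ⟨Qs, hQs, hQl⟩ := hLi q hq
    refine hLs (p + q) id (fun t => Ps t + Qs t) strictMono_id
      (fun t => (A t).add_mem (hPs t) (hQs t)) ?_
    simp only [hcoeffVec_add]
    exact hPl.add hQl
  have hLsmul : ∀ (c : ℂ) (p : MvPolynomial σ ℂ), p ∈ L → c • p ∈ L := by
    intro c p hp
    obtain ⟨Ps, hPs, hPl⟩ := hLi p hp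
    refine hLs (c • p) id (fun t => c • Ps t) strictMono_id (fun t => (A t).smul_mem c (hPs t)) ?_
    simp only [hcoeffVec_smul]
    exact hPl.const_smul c
  let Lk : Submodule ℂ (MvPolynomial σ ℂ) :=
    { carrier := L
      add_mem' := fun {p q} hp hq => hLadd p hp q hq
      zero_mem' := hL0
      smul_mem' := fun c p hp => hLsmul c p hp }
  have hLkV : Lk ≤ homogeneousSubmodule σ ℂ k := fun D hD =>
    (mem_homogeneousSubmodule k D).mpr (hLhom D hD)
  haveI : FiniteDimensional ℂ Lk := Submodule.finiteDimensional_of_le hLkV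
  refine ⟨Lk, rfl, hLkV, le_antisymm ?_ ?_⟩
  · -- Step 3: `finrank Lk ≤ d` (normalised dependence relations in `A t`)
    by_contra hgt
    push Not at hgt
    have hcard : d + 1 ≤ Module.finrank ℂ Lk := hgt
    let b := Module.finBasis ℂ Lk
    let e : Fin (d + 1) → Lk := fun i => b (Fin.castLE hcard i)
    have he : LinearIndependent ℂ e := b.linearIndependent.comp _ (Fin.castLE_injective hcard)
    have hex : ∀ i : Fin (d + 1), ∃ Ds : ℕ → MvPolynomial σ ℂ, (∀ t, Ds t ∈ A t) ∧
        Tendsto (fun t => coeffVec (Ds t)) atTop (𝓝 (coeffVec (e i : MvPolynomial σ ℂ))) :=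
      fun i => hLi _ (e i).2
    choose E hEA hElim using hex
    have hdep : ∀ t, ∃ c : Fin (d + 1) → ℂ, ‖c‖ = 1 ∧ ∑ i, c i • E i t = 0 := by
      intro t
      have hnot : ¬ LinearIndependent ℂ (fun i => (⟨E i t, hEA i t⟩ : A t)) := by
        intro hli
        have := hli.fintype_card_le_finrank
        rw [Fintype.card_fin, hd t] at this
        omega
      rw [Fintype.not_linearIndependent_iff] at hnot
      obtain ⟨g, hg, i, hi⟩ := hnot
      have hg0 : g ≠ 0 := fun h => hi (by rw [h]; rfl)
      have hn : ‖g‖ ≠ 0 := norm_ne_zero_iff.mpr hg0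
      have hsum : ∑ i, g i • E i t = 0 := by
        have := congrArg (fun x : A t => (x : MvPolynomial σ ℂ)) hg
        simpa using this
      refine ⟨((‖g‖⁻¹ : ℝ) : ℂ) • g, ?_, ?_⟩
      · rw [norm_smul, Complex.norm_real, norm_inv, norm_norm, inv_mul_cancel₀ hn]
      · simp only [Pi.smul_apply, smul_eq_mul, mul_smul, ← Finset.smul_sum, hsum, smul_zero]
    choose c hc1 hc0 using hdep
    obtain ⟨cl, hclS, φ, hφ, hclim⟩ := (isCompact_sphere (0 : Fin (d + 1) → ℂ) 1).tendsto_subseq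
      (x := c) (fun t => mem_sphere_zero_iff_norm.mpr (hc1 t))
    have hcl0 : cl ≠ 0 := by
      intro h
      rw [h, mem_sphere_zero_iff_norm, norm_zero] at hclS
      exact zero_ne_one hclS
    have hThom : ∀ i t, (E i t).IsHomogeneous k := fun i t => hAhom t _ (hEA i t)
    have hehom : ∀ i, (e i : MvPolynomial σ ℂ).IsHomogeneous k := fun i => hLhom _ (e i).2
    have hTlim : ∀ i, Tendsto (fun t => T k (E i (φ t))) atTop (𝓝 (T k (e i : MvPolynomial σ ℂ))) :=
      fun i => ((tendsto_T_iff k (hThom i) (hehom i)).mp (hElim i)).comp hφ.tendsto_atTop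
    have hclim' : ∀ i, Tendsto (fun t => c (φ t) i) atTop (𝓝 (cl i)) := fun i =>
      ((continuous_apply i).tendsto _).comp hclim
    have hsum : Tendsto (fun t => ∑ i, c (φ t) i • T k (E i (φ t))) atTop
        (𝓝 (∑ i, cl i • T k (e i : MvPolynomial σ ℂ))) :=
      tendsto_finsetSum _ fun i _ => (hclim' i).smul (hTlim i)
    have hzero : (fun t => ∑ i, c (φ t) i • T k (E i (φ t))) = fun _ => 0 := by
      funext t
      have := congrArg (T k) (hc0 (φ t))
      rw [map_sum, map_zero] at this
      simpa only [map_smul] using this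
    rw [hzero] at hsum
    have hlim0 : ∑ i, cl i • T k (e i : MvPolynomial σ ℂ) = 0 :=
      tendsto_nhds_unique hsum tendsto_const_nhds
    have hVsum : (∑ i, cl i • (e i : MvPolynomial σ ℂ)).IsHomogeneous k :=
      (mem_homogeneousSubmodule k _).mp
        ((homogeneousSubmodule σ ℂ k).sum_mem fun i _ =>
          (homogeneousSubmodule σ ℂ k).smul_mem _ (hLkV (e i).2))
    have key : ∑ i, cl i • (e i : MvPolynomial σ ℂ) = 0 := by
      apply (T_eq_zero_iff k hVsum).mp
      rw [map_sum]
      simpa only [map_smul] using hlim0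
    have key' : ∑ i, cl i • e i = 0 := by
      apply Subtype.ext
      simpa using key
    have := Fintype.linearIndependent_iff.mp he cl key'
    exact hcl0 (funext this)
  · -- Step 4: `d ≤ finrank Lk` (compactness; consumes (Ls))
    by_contra hlt
    push Not at hlt
    let LV : Submodule ℂ (homogeneousSubmodule σ ℂ k) := Lk.comap (homogeneousSubmodule σ ℂ k).subtype
    have hLV : Module.finrank ℂ LV = Module.finrank ℂ Lk :=
      (Submodule.comapSubtypeEquivOfLe hLkV).finrank_eq
    obtain ⟨W, hW⟩ := LV.exists_isCompl
    have hWdim : Module.finrank ℂ LV + Module.finrank ℂ W =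
        Module.finrank ℂ (homogeneousSubmodule σ ℂ k) :=
      Submodule.finrank_add_eq_of_isCompl hW
    -- in each `A t`, a nonzero vector of `W`
    have hAt : ∀ t, ∃ w : homogeneousSubmodule σ ℂ k,
        (w : MvPolynomial σ ℂ) ∈ A t ∧ w ∈ W ∧ w ≠ 0 := by
      intro t
      let At : Submodule ℂ (homogeneousSubmodule σ ℂ k) :=
        (A t).comap (homogeneousSubmodule σ ℂ k).subtype
      have hAtd : Module.finrank ℂ At = d := by
        rw [(Submodule.comapSubtypeEquivOfLe (hA t)).finrank_eq, hd t]
      have hsup : Module.finrank ℂ ↥(At ⊔ W) ≤ Module.finrank ℂ (homogeneousSubmodule σ ℂ k) :=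
        Submodule.finrank_le _
      have hinf := Submodule.finrank_sup_add_finrank_inf_eq At W
      have hpos : 0 < Module.finrank ℂ ↥(At ⊓ W) := by omega
      have hne : At ⊓ W ≠ ⊥ := by
        intro h
        rw [h, finrank_bot] at hpos
        exact lt_irrefl _ hpos
      obtain ⟨x, hx, hx0⟩ := Submodule.exists_mem_ne_zero_of_ne_bot hne
      exact ⟨x, (Submodule.mem_inf.mp hx).1, (Submodule.mem_inf.mp hx).2, hx0⟩
    choose w hwA hwW hw0 using hAt
    have hwhom : ∀ t, ((w t : homogeneousSubmodule σ ℂ k) : MvPolynomial σ ℂ).IsHomogeneous k :=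
      fun t => hAhom t _ (hwA t)
    have hT0 : ∀ t, T k ((w t : homogeneousSubmodule σ ℂ k) : MvPolynomial σ ℂ) ≠ 0 := by
      intro t h
      apply hw0 t
      apply Subtype.ext
      exact (T_eq_zero_iff k (hwhom t)).mp h
    set r : ℕ → ℂ := fun t => ((‖T k ((w t : homogeneousSubmodule σ ℂ k) : MvPolynomial σ ℂ)‖⁻¹ : ℝ) : ℂ)
      with hr
    have hsph : ∀ t, r t • T k ((w t : homogeneousSubmodule σ ℂ k) : MvPolynomial σ ℂ) ∈
        Metric.sphere (0 : degF σ k → ℂ) 1 := by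
      intro t
      rw [mem_sphere_zero_iff_norm, norm_smul, hr]
      simp only [Complex.norm_real, norm_inv, norm_norm]
      exact inv_mul_cancel₀ (norm_ne_zero_iff.mpr (hT0 t))
    obtain ⟨v, hvS, φ, hφ, hvlim⟩ := (isCompact_sphere (0 : degF σ k → ℂ) 1).tendsto_subseq hsph
    have hv0 : v ≠ 0 := by
      intro h
      rw [h, mem_sphere_zero_iff_norm, norm_zero] at hvS
      exact zero_ne_one hvS
    -- the limit form
    set ℓ := S k v with hℓ
    have hℓhom : ℓ.IsHomogeneous k := isHomogeneous_S k v
    have hTℓ : T k ℓ = v := T_S k v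
    -- `ℓ ∈ L` by (Ls)
    have hℓL : ℓ ∈ L := by
      refine hLs ℓ φ (fun t => r (φ t) • ((w (φ t) : homogeneousSubmodule σ ℂ k) : MvPolynomial σ ℂ)) hφ
        (fun t => (A (φ t)).smul_mem _ (hwA (φ t))) ?_
      rw [tendsto_T_iff k (fun t => ?_) hℓhom]
      · simpa only [map_smul, hTℓ, Function.comp_def] using hvlim
      · exact (mem_homogeneousSubmodule k _).mp
          ((homogeneousSubmodule σ ℂ k).smul_mem _ (w (φ t)).2)
    -- `ℓ ∈ W` by closedness of finite-dimensional subspaces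
    have hℓV : ℓ ∈ homogeneousSubmodule σ ℂ k := (mem_homogeneousSubmodule k ℓ).mpr hℓhom
    have hℓW : (⟨ℓ, hℓV⟩ : homogeneousSubmodule σ ℂ k) ∈ W := by
      let W' : Submodule ℂ (degF σ k → ℂ) := W.map ((T k).comp (homogeneousSubmodule σ ℂ k).subtype)
      have hW'closed : IsClosed (W' : Set (degF σ k → ℂ)) := W'.closed_of_finiteDimensional
      have hmemW' : ∀ t, r (φ t) • T k ((w (φ t) : homogeneousSubmodule σ ℂ k) : MvPolynomial σ ℂ) ∈ W' :=
        fun t => W'.smul_mem _ (Submodule.mem_map_of_mem (hwW (φ t)))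
      have hvW' : v ∈ W' := hW'closed.mem_of_tendsto hvlim (Eventually.of_forall hmemW')
      obtain ⟨w₀, hw₀W, hw₀v⟩ := Submodule.mem_map.mp hvW'
      have : (⟨ℓ, hℓV⟩ : homogeneousSubmodule σ ℂ k) = w₀ := by
        apply Subtype.ext
        show ℓ = (w₀ : MvPolynomial σ ℂ)
        apply eq_of_T_eq k hℓhom ((mem_homogeneousSubmodule k _).mp w₀.2)
        rw [hTℓ, ← hw₀v]
        rfl
      rw [this]
      exact hw₀W
    have hℓLV : (⟨ℓ, hℓV⟩ : homogeneousSubmodule σ ℂ k) ∈ LV := hℓL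
    have hzero : (⟨ℓ, hℓV⟩ : homogeneousSubmodule σ ℂ k) = 0 := by
      have := hW.disjoint
      rw [Submodule.disjoint_def] at this
      exact this _ hℓLV hℓW
    have hℓ0 : ℓ = 0 := congrArg Subtype.val hzero
    apply hv0
    rw [← hTℓ, hℓ0, map_zero]

end

end DrefuteProbe.Kuratowski


/-! ## Part B -/

namespace DrefuteProbe.AnnDim

open Summit.ValiantsHypothesis.ValiantsHypothesis.Cruxes.FixedWitnessObstructionQP.Disproof.Bilin
open Literature.Barriers.ValiantsHypothesis (iterPDeriv derivSet iterPDeriv_nil iterPDeriv_cons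
  shiftedPartialsRank_zero_eq flatteningRank_detPoly)
open MvPolynomial Filter Topology
open scoped BigOperators Matrix
open Literature.Computability.AlgebraicComplexity

set_option linter.unusedSectionVars false

noncomputable section

section Coord

variable {σ : Type} [Fintype σ] [DecidableEq σ]

/-- Degree-`k` exponents, as a finset. -/
def degF (σ : Type) [Fintype σ] [DecidableEq σ] (k : ℕ) : Finset (σ →₀ ℕ) :=
  (Finset.univ : Finset σ).finsuppAntidiag k

theorem mem_degF {k : ℕ} {u : σ →₀ ℕ} : u ∈ degF σ k ↔ u.degree = k := by
  rw [degF, Finset.mem_finsuppAntidiag, Finsupp.degree_eq_sum]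
  simp

/-- Restriction of the coefficient vector to degree `k`. -/
def T (k : ℕ) : MvPolynomial σ ℂ →ₗ[ℂ] (degF σ k → ℂ) where
  toFun p := fun u => coeff u.1 p
  map_add' p q := by funext u; simp
  map_smul' c p := by funext u; simp

theorem T_apply (k : ℕ) (p : MvPolynomial σ ℂ) (u : degF σ k) : T k p u = coeff u.1 p := rfl

/-- The degree-`k` form with prescribed degree-`k` coefficients. -/
def S (k : ℕ) (v : degF σ k → ℂ) : MvPolynomial σ ℂ := ∑ u : degF σ k, monomial u.1 (v u)

theorem coeff_S (k : ℕ) (v : degF σ k → ℂ) (w : σ →₀ ℕ) :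
    coeff w (S k v) = if h : w ∈ degF σ k then v ⟨w, h⟩ else 0 := by
  rw [S, coeff_sum]
  simp only [coeff_monomial]
  split_ifs with h
  · rw [Finset.sum_eq_single ⟨w, h⟩]
    · simp
    · intro u _ hu
      rw [if_neg]
      intro heq
      exact hu (Subtype.ext heq)
    · intro hu
      exact absurd (Finset.mem_univ _) hu
  · apply Finset.sum_eq_zero
    intro u _
    rw [if_neg]
    intro heq
    exact h (heq ▸ u.2)

theorem isHomogeneous_S (k : ℕ) (v : degF σ k → ℂ) : (S k v).IsHomogeneous k := by
  unfold S
  apply IsHomogeneous.sum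
  intro u _
  exact isHomogeneous_monomial _ (mem_degF.mp u.2)

theorem T_S (k : ℕ) (v : degF σ k → ℂ) : T k (S k v) = v := by
  funext u
  rw [T_apply, coeff_S, dif_pos u.2]

theorem S_T (k : ℕ) {p : MvPolynomial σ ℂ} (hp : p.IsHomogeneous k) : S k (T k p) = p := by
  ext w
  rw [coeff_S]
  split_ifs with h
  · rfl
  · exact (hp.coeff_eq_zero (fun hw => h (mem_degF.mpr hw))).symm

theorem eq_of_T_eq (k : ℕ) {p q : MvPolynomial σ ℂ} (hp : p.IsHomogeneous k) (hq : q.IsHomogeneous k)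
    (h : T k p = T k q) : p = q := by
  rw [← S_T k hp, ← S_T k hq, h]

theorem T_eq_zero_iff (k : ℕ) {p : MvPolynomial σ ℂ} (hp : p.IsHomogeneous k) : T k p = 0 ↔ p = 0 :=
  ⟨fun h => eq_of_T_eq k hp (isHomogeneous_zero σ ℂ k) (by rw [h, map_zero]),
    fun h => by rw [h, map_zero]⟩

/-- Coefficientwise convergence of degree-`k` forms = convergence of the degree-`k` coordinates. -/
theorem tendsto_T_iff (k : ℕ) {x : ℕ → MvPolynomial σ ℂ} {p : MvPolynomial σ ℂ}
    (hx : ∀ t, (x t).IsHomogeneous k) (hp : p.IsHomogeneous k) :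
    Tendsto (fun t => coeffVec (x t)) atTop (𝓝 (coeffVec p)) ↔
      Tendsto (fun t => T k (x t)) atTop (𝓝 (T k p)) := by
  rw [tendsto_pi_nhds, tendsto_pi_nhds]
  constructor
  · intro h u
    exact h u.1
  · intro h w
    by_cases hw : w.degree = k
    · exact h ⟨w, mem_degF.mpr hw⟩
    · have h1 : (fun t => coeffVec (x t) w) = fun _ => (0 : ℂ) :=
        funext fun t => (hx t).coeff_eq_zero hw
      have h2 : coeffVec p w = 0 := hp.coeff_eq_zero hw
      rw [h1, h2]
      exact tendsto_const_nhds

end Coord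

section Lists

variable {σ : Type} [Fintype σ] [DecidableEq σ]

theorem apolarAction_one' (g : MvPolynomial σ ℂ) : apolarAction (1 : MvPolynomial σ ℂ) g = g := by
  rw [← C_1, apolarAction_C, one_smul]

/-- Exponent of a list of variables. -/
def lsum (l : List σ) : σ →₀ ℕ := (l.map fun i => Finsupp.single i 1).sum

theorem lsum_nil : lsum ([] : List σ) = 0 := rfl

theorem lsum_cons (a : σ) (l : List σ) : lsum (a :: l) = Finsupp.single a 1 + lsum l := by
  simp [lsum]

theorem prod_map_X (l : List σ) : ((l.map X).prod : MvPolynomial σ ℂ) = monomial (lsum l) 1 := by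
  induction l with
  | nil => simp [lsum_nil]
  | cons a l ih =>
    rw [List.map_cons, List.prod_cons, ih, lsum_cons, X, monomial_mul, one_mul]

theorem lsum_coe (l : List σ) : lsum l = Multiset.toFinsupp (l : Multiset σ) := by
  induction l with
  | nil => simp [lsum_nil]
  | cons a l ih =>
    rw [lsum_cons, ih, ← Multiset.cons_coe, ← Multiset.singleton_add, Multiset.toFinsupp_add,
      Multiset.toFinsupp_singleton]

theorem lsum_toList (T : Multiset σ) : lsum T.toList = Multiset.toFinsupp T := by
  rw [lsum_coe, Multiset.coe_toList]

theorem lsum_toList_toMultiset (f : σ →₀ ℕ) : lsum (Finsupp.toMultiset f).toList = f := by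
  rw [lsum_toList, Finsupp.toMultiset_toFinsupp]

theorem degree_toFinsupp (T : Multiset σ) : (Multiset.toFinsupp T).degree = Multiset.card T := by
  have h := Finsupp.card_toMultiset (Multiset.toFinsupp T)
  rw [Multiset.toFinsupp_toMultiset] at h
  rw [h]
  rfl

theorem degree_lsum (l : List σ) : (lsum l).degree = l.length := by
  rw [lsum_coe, degree_toFinsupp, Multiset.coe_card]

/-- Monomial operators act as iterated partial derivatives. -/
theorem apolar_prod_map_X (l : List σ) (f : MvPolynomial σ ℂ) :
    apolarAction (l.map X).prod f = iterPDeriv l f := by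
  induction l with
  | nil => rw [List.map_nil, List.prod_nil, apolarAction_one', iterPDeriv_nil]
  | cons i l ih => rw [List.map_cons, List.prod_cons, apolarAction_mul, ih, apolarAction_X, iterPDeriv_cons]

end Lists

section Flattening

variable {σ : Type} [Fintype σ] [DecidableEq σ]

instance finiteDimensional_homogeneousSubmodule (k : ℕ) :
    FiniteDimensional ℂ (homogeneousSubmodule σ ℂ k) :=
  Submodule.finiteDimensional_of_le (S₂ := restrictTotalDegree σ ℂ k) fun E hE =>
    (mem_restrictTotalDegree _ _ _).mpr ((mem_homogeneousSubmodule k E).mp hE).totalDegree_le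

/-- The flattening `D ↦ D ⌟ f` on degree-`k` forms. -/
def Φ (k : ℕ) (f : MvPolynomial σ ℂ) : homogeneousSubmodule σ ℂ k →ₗ[ℂ] MvPolynomial σ ℂ where
  toFun D := apolarAction (D : MvPolynomial σ ℂ) f
  map_add' D E := by simp [apolarAction_add_left]
  map_smul' c D := by simp [apolarAction_smul_left]

theorem Φ_apply (k : ℕ) (f : MvPolynomial σ ℂ) (D : homogeneousSubmodule σ ℂ k) :
    Φ k f D = apolarAction (D : MvPolynomial σ ℂ) f := rfl

/-- `Ann_k(f)` as a submodule. -/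
def annSub (k : ℕ) (f : MvPolynomial σ ℂ) : Submodule ℂ (MvPolynomial σ ℂ) :=
  (LinearMap.ker (Φ k f)).map (homogeneousSubmodule σ ℂ k).subtype

theorem mem_annSub {k : ℕ} {f D : MvPolynomial σ ℂ} :
    D ∈ annSub k f ↔ D.IsHomogeneous k ∧ apolarAction D f = 0 := by
  simp only [annSub, Submodule.mem_map, LinearMap.mem_ker, Φ_apply, Submodule.subtype_apply]
  constructor
  · rintro ⟨E, hE, rfl⟩
    exact ⟨(mem_homogeneousSubmodule k _).mp E.2, hE⟩
  · rintro ⟨h1, h2⟩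
    exact ⟨⟨D, (mem_homogeneousSubmodule k D).mpr h1⟩, h2, rfl⟩

theorem coe_annSub (k : ℕ) (f : MvPolynomial σ ℂ) :
    (annSub k f : Set (MvPolynomial σ ℂ)) = annihilatorOfDegree f k := by
  ext D
  rw [SetLike.mem_coe, mem_annSub, mem_annihilatorOfDegree_iff]

theorem annSub_le (k : ℕ) (f : MvPolynomial σ ℂ) : annSub k f ≤ homogeneousSubmodule σ ℂ k :=
  fun D hD => (mem_homogeneousSubmodule k D).mpr (mem_annSub.mp hD).1

theorem finrank_annSub_add (k : ℕ) (f : MvPolynomial σ ℂ) :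
    Module.finrank ℂ (annSub k f) + Module.finrank ℂ (LinearMap.range (Φ k f)) =
      Module.finrank ℂ (homogeneousSubmodule σ ℂ k) := by
  rw [annSub, Submodule.finrank_map_subtype_eq, add_comm]
  exact LinearMap.finrank_range_add_finrank_ker (Φ k f)

/-- Degree-`k` exponents ≃ `k`-multisets of variables. -/
def degFEquivSym (k : ℕ) : degF σ k ≃ Sym σ k where
  toFun u := ⟨Finsupp.toMultiset u.1, by
    have h := Finsupp.card_toMultiset u.1
    rw [h]
    exact mem_degF.mp u.2⟩
  invFun s := ⟨Multiset.toFinsupp (s : Multiset σ), mem_degF.mpr (by rw [degree_toFinsupp, Sym.card_coe])⟩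
  left_inv u := by
    apply Subtype.ext
    simp [Finsupp.toMultiset_toFinsupp]
  right_inv s := by
    apply Sym.coe_injective
    simp [Multiset.toFinsupp_toMultiset]

/-- The degree-`k` forms are the coordinate space on degree-`k` exponents. -/
def TV (k : ℕ) : homogeneousSubmodule σ ℂ k ≃ₗ[ℂ] (degF σ k → ℂ) :=
  LinearEquiv.ofBijective ((T k).comp (homogeneousSubmodule σ ℂ k).subtype)
    ⟨fun D E h => Subtype.ext (eq_of_T_eq k ((mem_homogeneousSubmodule k _).mp D.2)
        ((mem_homogeneousSubmodule k _).mp E.2) h),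
     fun v => ⟨⟨S k v, (mem_homogeneousSubmodule k _).mpr (isHomogeneous_S k v)⟩, T_S k v⟩⟩

theorem finrank_homogeneousSubmodule (k : ℕ) :
    Module.finrank ℂ (homogeneousSubmodule σ ℂ k) = (Fintype.card σ + k - 1).choose k := by
  rw [(TV k).finrank_eq, Module.finrank_fintype_fun_eq_card, ← Sym.card_sym_eq_choose]
  exact Fintype.card_congr (degFEquivSym k)

/-- The image of the flattening is the span of the `k`-th order partials. -/
theorem range_Φ (k : ℕ) (f : MvPolynomial σ ℂ) :
    LinearMap.range (Φ k f) = Submodule.span ℂ (derivSet k f) := by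
  apply le_antisymm
  · rintro _ ⟨D, rfl⟩
    have hD : (D : MvPolynomial σ ℂ).IsHomogeneous k := (mem_homogeneousSubmodule k _).mp D.2
    rw [Φ_apply, (D : MvPolynomial σ ℂ).as_sum, apolarAction_sum_left]
    refine Submodule.sum_mem _ fun u hu => ?_
    have hmon : monomial u (coeff u (D : MvPolynomial σ ℂ)) = coeff u (D : MvPolynomial σ ℂ) • monomial u (1 : ℂ) := by
      rw [smul_monomial, smul_eq_mul, mul_one]
    rw [hmon, apolarAction_smul_left]
    refine Submodule.smul_mem _ _ (Submodule.subset_span ?_)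
    refine ⟨(Finsupp.toMultiset u).toList, ?_, ?_⟩
    · rw [Multiset.length_toList, Finsupp.card_toMultiset]
      have hdeg : u.degree = k := by
        rw [Finsupp.degree_eq_weight_one]; exact hD (mem_support_iff.mp hu)
      rw [← hdeg]
      rfl
    · rw [← apolar_prod_map_X, prod_map_X, lsum_toList_toMultiset]
  · rw [Submodule.span_le]
    rintro _ ⟨l, hl, rfl⟩
    refine ⟨⟨monomial (lsum l) 1, (mem_homogeneousSubmodule k _).mpr
      (isHomogeneous_monomial _ (by rw [degree_lsum, hl]))⟩, ?_⟩
    rw [Φ_apply]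
    show apolarAction (monomial (lsum l) 1) f = iterPDeriv l f
    rw [← prod_map_X, apolar_prod_map_X]

end Flattening

/-! ### The determinant -/

theorem finrank_range_det (m k : ℕ) :
    Module.finrank ℂ (LinearMap.range (Φ k (detPoly (Fin m) ℂ))) = (m.choose k) ^ 2 := by
  rw [range_Φ, ← shiftedPartialsRank_zero_eq, flatteningRank_detPoly]

theorem finrank_annSub_det (m k : ℕ) :
    Module.finrank ℂ (annSub k (detPoly (Fin m) ℂ)) = Nat.choose (m * m + k - 1) k - (Nat.choose m k) ^ 2 := by
  have h := finrank_annSub_add k (detPoly (Fin m) ℂ)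
  rw [finrank_range_det, finrank_homogeneousSubmodule, Fintype.card_prod, Fintype.card_fin] at h
  omega

/-- The linear automorphism of `𝕊` given by an invertible substitution. -/
def linEquiv {σ : Type} [Fintype σ] [DecidableEq σ] (A B : Matrix σ σ ℂ) (hAB : A * B = 1)
    (hBA : B * A = 1) : MvPolynomial σ ℂ ≃ₗ[ℂ] MvPolynomial σ ℂ :=
  { (linSubst σ ℂ A).toLinearMap with
    invFun := linSubst σ ℂ B
    left_inv := fun p => by
      show linSubst σ ℂ B (linSubst σ ℂ A p) = p
      rw [← AlgHom.comp_apply, ← linSubst_mul, hBA, linSubst_one]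
      rfl
    right_inv := fun p => by
      show linSubst σ ℂ A (linSubst σ ℂ B p) = p
      rw [← AlgHom.comp_apply, ← linSubst_mul, hAB, linSubst_one]
      rfl }

/-- **Stub 3 of `cone-purity-squeeze`, verbatim.** -/
theorem stub_annSubmodule (m k : ℕ) (P : MvPolynomial (Fin m × Fin m) ℂ)
    (hP : P ∈ glOrbit (Fin m × Fin m) ℂ (detPoly (Fin m) ℂ)) :
    ∃ A : Submodule ℂ (MvPolynomial (Fin m × Fin m) ℂ),
      (A : Set (MvPolynomial (Fin m × Fin m) ℂ)) = annihilatorOfDegree P k ∧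
      A ≤ MvPolynomial.homogeneousSubmodule (Fin m × Fin m) ℂ k ∧
      Module.finrank ℂ A = Nat.choose (m * m + k - 1) k - (Nat.choose m k) ^ 2 := by
  classical
  obtain ⟨g, rfl⟩ := hP
  refine ⟨annSub k _, coe_annSub k _, annSub_le k _, ?_⟩
  set G : Matrix (Fin m × Fin m) (Fin m × Fin m) ℂ :=
    (g : Matrix (Fin m × Fin m) (Fin m × Fin m) ℂ) with hG
  set Gi : Matrix (Fin m × Fin m) (Fin m × Fin m) ℂ :=
    ((g⁻¹ : GL (Fin m × Fin m) ℂ) : Matrix (Fin m × Fin m) (Fin m × Fin m) ℂ) with hGi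
  have hGG : G * Gi = 1 := Units.mul_inv g
  have hGG' : Gi * G = 1 := Units.inv_mul g
  have hunit : IsUnit G.det := Matrix.isUnit_det_of_right_inverse hGG
  let E := linEquiv Gᵀ Giᵀ (by rw [← Matrix.transpose_mul, hGG', Matrix.transpose_one])
    (by rw [← Matrix.transpose_mul, hGG, Matrix.transpose_one])
  have hE : ∀ D, E D = linSubst _ ℂ Gᵀ D := fun D => rfl
  have hEs : ∀ D, E.symm D = linSubst _ ℂ Giᵀ D := fun D => rfl
  have heq : annSub k (linSubstRep (Fin m × Fin m) ℂ g (detPoly (Fin m) ℂ)) =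
      (annSub k (detPoly (Fin m) ℂ)).map (E.symm : _ →ₗ[ℂ] _) := by
    ext D
    rw [Submodule.mem_map_equiv, LinearEquiv.symm_symm, mem_annSub, mem_annSub, linSubstRep_apply, hE,
      apolarAction_linSubst_eq_zero_iff _ hunit]
    constructor
    · rintro ⟨h1, h2⟩
      exact ⟨linSubst_isHomogeneous _ h1, h2⟩
    · rintro ⟨h1, h2⟩
      refine ⟨?_, h2⟩
      have h3 := linSubst_isHomogeneous Giᵀ h1
      rw [← hE, ← hEs, LinearEquiv.symm_apply_apply] at h3
      exact h3
  show Module.finrank ℂ (annSub k (linSubstRep (Fin m × Fin m) ℂ g (detPoly (Fin m) ℂ))) = _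
  rw [heq, LinearEquiv.finrank_map_eq, finrank_annSub_det]

end

end DrefuteProbe.AnnDim


open MvPolynomial Filter
open scoped BigOperators Matrix
open Literature.Computability.AlgebraicComplexity

namespace DrefuteProbe

section Transv
variable {ι : Type*} [Fintype ι] [DecidableEq ι]

omit [Fintype ι] in
theorem transv_apply (y z a b : ι) (c : ℂ) :
    ((1 : Matrix ι ι ℂ) + c • Matrix.single y z (1 : ℂ)) a b =
      (if a = b then (1 : ℂ) else 0) + c * (if y = a ∧ z = b then 1 else 0) := by
  simp only [Matrix.add_apply, Matrix.one_apply, Matrix.smul_apply, Matrix.single_apply, smul_eq_mul]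

omit [Fintype ι] in
theorem transv_diag {y z : ι} (hyz : y ≠ z) (c : ℂ) (p : ι) :
    ((1 : Matrix ι ι ℂ) + c • Matrix.single y z (1 : ℂ)) p p = 1 := by
  rw [transv_apply, if_pos rfl, if_neg]
  · ring
  · rintro ⟨h1, h2⟩
    exact hyz (h1.trans h2.symm)

omit [Fintype ι] in
theorem transv_offdiag {y z a b : ι} (hab : a ≠ b) (c : ℂ) :
    ((1 : Matrix ι ι ℂ) + c • Matrix.single y z (1 : ℂ)) a b = c * (if y = a ∧ z = b then 1 else 0) := by
  rw [transv_apply, if_neg hab, zero_add]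

theorem transv_det {y z : ι} (hyz : y ≠ z) (c : ℂ) :
    ((1 : Matrix ι ι ℂ) + c • Matrix.single y z (1 : ℂ)).det = 1 := by
  have : (1 : Matrix ι ι ℂ) + c • Matrix.single y z (1 : ℂ) = Matrix.transvection y z c := by
    simp [Matrix.transvection]
  rw [this, Matrix.det_transvection_of_ne _ _ hyz]

omit [Fintype ι] in
theorem transv_transpose (y z : ι) (c : ℂ) :
    ((1 : Matrix ι ι ℂ) + c • Matrix.single y z (1 : ℂ))ᵀ = 1 + c • Matrix.single z y (1 : ℂ) := by
  rw [Matrix.transpose_add, Matrix.transpose_one, Matrix.transpose_smul, Matrix.transpose_single]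

theorem diagUpdate_det (z : ι) {d : ℂ} (hd : d ≠ 0) :
    (Matrix.diagonal (Function.update (1 : ι → ℂ) z d)).det ≠ 0 := by
  rw [Matrix.det_diagonal, Finset.prod_update_of_mem (Finset.mem_univ z)]
  simp [hd]

omit [Fintype ι] in
theorem diagUpdate_apply_of_ne {z p : ι} (h : p ≠ z) (d : ℂ) :
    Matrix.diagonal (Function.update (1 : ι → ℂ) z d) p p = 1 := by
  rw [Matrix.diagonal_apply_eq, Function.update_of_ne h, Pi.one_apply]

end Transv

theorem rk_own_lt {m : ℕ} (p : Fin m × Fin m) : (p.1 : ℕ) * m + (p.2 : ℕ) < m * m := by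
  have h1 : (p.1 : ℕ) + 1 ≤ m := p.1.isLt
  have h2 : (p.2 : ℕ) < m := p.2.isLt
  calc (p.1 : ℕ) * m + p.2 < p.1 * m + m := Nat.add_lt_add_left h2 _
    _ = ((p.1 : ℕ) + 1) * m := by ring
    _ ≤ m * m := Nat.mul_le_mul_right m h1

/-- Stub 2 verbatim. -/
theorem stub_h0Elementary (n m : ℕ) [NeZero m] (J : ℕ → Set (MvPolynomial (Fin m × Fin m) ℂ))
    (hW4 : ∀ A : Matrix.GeneralLinearGroup (Fin m × Fin m) ℂ,
      let M : Matrix (Fin m × Fin m) (Fin m × Fin m) ℂ := A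
      let rk := fun (p : Fin m × Fin m) =>
        (if (m - n ≤ (p.1 : ℕ) ∧ m - n ≤ (p.2 : ℕ)) ∨ p = (0, 0) then 0 else m * m) + ((p.1 : ℕ) * m + (p.2 : ℕ))
      (∀ i j : Fin m × Fin m, M j i ≠ 0 → rk j ≤ rk i) →
      (∀ i j : Fin m × Fin m, ((m - n ≤ (i.1 : ℕ) ∧ m - n ≤ (i.2 : ℕ)) ∨ i = (0, 0)) → j ≠ i → M j i = 0) →
      (∀ i k j l : Fin m, m - n ≤ (i : ℕ) → m - n ≤ (k : ℕ) → m - n ≤ (j : ℕ) → m - n ≤ (l : ℕ) →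
        M (i, j) (i, j) * M (k, l) (k, l) = M (i, l) (i, l) * M (k, j) (k, j)) →
      M (0, 0) (0, 0) ^ (m - n) * ∏ i ∈ Finset.univ.filter (fun i : Fin m => m - n ≤ (i : ℕ)), M (i, i) (i, i) = 1 →
      ∀ k ≤ m, ∀ D ∈ J k, linSubst (Fin m × Fin m) ℂ Mᵀ D ∈ J k) :
    ∀ k ≤ m,
      (∀ y z : Fin m × Fin m,
        ((m - n ≤ (y.1 : ℕ) ∧ m - n ≤ (y.2 : ℕ)) ∨ y = (0, 0)) →
        ¬ ((m - n ≤ (z.1 : ℕ) ∧ m - n ≤ (z.2 : ℕ)) ∨ z = (0, 0)) →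
        ∀ c : ℂ, ∀ D ∈ J k, linSubst (Fin m × Fin m) ℂ (1 + c • Matrix.single z y (1 : ℂ)) D ∈ J k) ∧
      (∀ z : Fin m × Fin m,
        ¬ ((m - n ≤ (z.1 : ℕ) ∧ m - n ≤ (z.2 : ℕ)) ∨ z = (0, 0)) →
        ∀ d : ℂ, d ≠ 0 → ∀ D ∈ J k,
          linSubst (Fin m × Fin m) ℂ (Matrix.diagonal (Function.update 1 z d)) D ∈ J k) := by
  classical
  intro k hk
  constructor
  · intro y z hy hz c D hD
    have hyz : y ≠ z := by
      rintro rfl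
      exact hz hy
    have key := hW4 (Matrix.GeneralLinearGroup.mkOfDetNeZero _ ((transv_det hyz c).symm ▸ one_ne_zero))
    simp only [Matrix.GeneralLinearGroup.val_mkOfDetNeZero, transv_transpose] at key
    refine key ?_ ?_ ?_ ?_ k hk D hD
    · intro i j hij
      by_cases hji : j = i
      · subst hji
        exact le_rfl
      · rw [transv_offdiag hji] at hij
        have hyj : y = j ∧ z = i := by
          by_contra hcon
          rw [if_neg hcon, mul_zero] at hij
          exact hij rfl
        obtain ⟨rfl, rfl⟩ := hyj
        rw [if_pos hy, if_neg hz]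
        have := rk_own_lt y
        omega
    · intro i j hi hji
      rw [transv_offdiag hji, if_neg, mul_zero]
      rintro ⟨rfl, rfl⟩
      exact hz hi
    · intro i k' j l _ _ _ _
      simp only [transv_diag hyz]
    · simp only [transv_diag hyz, one_pow, one_mul, Finset.prod_const_one]
  · intro z hz d hd D hD
    have hz' : ∀ p : Fin m × Fin m, ((m - n ≤ (p.1 : ℕ) ∧ m - n ≤ (p.2 : ℕ)) ∨ p = (0, 0)) → p ≠ z := by
      rintro p hp rfl
      exact hz hp
    have key := hW4 (Matrix.GeneralLinearGroup.mkOfDetNeZero _ (diagUpdate_det z hd))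
    simp only [Matrix.GeneralLinearGroup.val_mkOfDetNeZero, Matrix.diagonal_transpose] at key
    refine key ?_ ?_ ?_ ?_ k hk D hD
    · intro i j hij
      by_cases hji : j = i
      · subst hji
        exact le_rfl
      · exact absurd (Matrix.diagonal_apply_ne _ hji) hij
    · intro i j _ hji
      exact Matrix.diagonal_apply_ne _ hji
    · intro i k' j l hi hk' hj hl
      rw [diagUpdate_apply_of_ne (hz' _ (Or.inl ⟨hi, hj⟩)), diagUpdate_apply_of_ne (hz' _ (Or.inl ⟨hk', hl⟩)),
        diagUpdate_apply_of_ne (hz' _ (Or.inl ⟨hi, hl⟩)), diagUpdate_apply_of_ne (hz' _ (Or.inl ⟨hk', hj⟩))]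
    · rw [diagUpdate_apply_of_ne (hz' _ (Or.inr rfl)), one_pow, one_mul]
      refine Finset.prod_eq_one fun i hi => ?_
      rw [Finset.mem_filter] at hi
      exact diagUpdate_apply_of_ne (hz' _ (Or.inl ⟨hi.2, hi.2⟩)) d

end DrefuteProbe


/-! ## drefute probe: `stub_limitIdeal` of line `cone-purity-squeeze`, verbatim, from the API above -/

namespace DrefuteProbe

open Literature.Computability.AlgebraicComplexity
open MvPolynomial Filter
open Summit.ValiantsHypothesis.ValiantsHypothesis.Cruxes.FixedWitnessObstructionQP.Disproof.Bilin

/-- Stub 5 verbatim: limits of annihilator ideals are closed under the degree-one multipliers. -/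
theorem stub_limitIdeal (m : ℕ) (P : ℕ → MvPolynomial (Fin m × Fin m) ℂ)
    (J : ℕ → Set (MvPolynomial (Fin m × Fin m) ℂ)) (hJ : IsBorderApolarLimit m P J) :
    ∀ k : ℕ, k + 1 ≤ m → ∀ D ∈ J k, ∀ i : Fin m × Fin m, D * MvPolynomial.X i ∈ J (k + 1) := by
  classical
  intro k hk D hD i
  have hkm : k ≤ m := Nat.le_of_succ_le hk
  obtain ⟨Ds, hDs, hlim⟩ := hJ.exists_tendsto hkm hD
  rw [mul_comm]
  refine hJ.mem_of_tendsto (k := k + 1) hk (φ := id) (Ds := fun t => X i * Ds t)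
    strictMono_id (fun t => ⟨?_, ?_⟩) (tendsto_coeffVec_X_mul i hlim)
  · have := (isHomogeneous_X ℂ i).mul (hDs t).1
    rwa [add_comm] at this
  · change apolarAction (X i * Ds t) (P t) = 0
    rw [apolarAction_X_mul, (hDs t).2, apolarAction_zero_right]

end DrefuteProbe



/-! ## The line reduction -/

namespace DrefuteProbe.LineReduction

open MvPolynomial Filter
open scoped BigOperators Matrix
open Literature.Computability.AlgebraicComplexity
open Summit.ValiantsHypothesis.ValiantsHypothesis.Theses.BorderApolarity

set_option linter.unusedSectionVars false

/-- The climb = `stub_pureBorderObstruction` of `Lines/cone-purity-squeeze.lean`, verbatim. -/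
def Climb : Prop :=
    ∀ c : ℕ, ∃ n₀ : ℕ, ∀ n ≥ n₀, ∀ (m : ℕ) [NeZero m], n ≤ m → m ≤ 2 ^ ((Nat.log 2 n + c) ^ c) →
      ¬ ∃ (P : ℕ → MvPolynomial (Fin m × Fin m) ℂ) (J : ℕ → Set (MvPolynomial (Fin m × Fin m) ℂ)),
        (∀ t : ℕ, P t ∈ glOrbit (Fin m × Fin m) ℂ (detPoly (Fin m) ℂ)) ∧
        IsBorderApolarLimit m P J ∧
        (∀ A : Matrix.GeneralLinearGroup (Fin m × Fin m) ℂ,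
          let M : Matrix (Fin m × Fin m) (Fin m × Fin m) ℂ := A
          let rk := fun (p : Fin m × Fin m) =>
            (if (m - n ≤ (p.1 : ℕ) ∧ m - n ≤ (p.2 : ℕ)) ∨ p = (0, 0) then 0 else m * m) +
              ((p.1 : ℕ) * m + (p.2 : ℕ))
          (∀ i j : Fin m × Fin m, M j i ≠ 0 → rk j ≤ rk i) →
          (∀ i j : Fin m × Fin m, ((m - n ≤ (i.1 : ℕ) ∧ m - n ≤ (i.2 : ℕ)) ∨ i = (0, 0)) → j ≠ i → M j i = 0) →
          (∀ i k j l : Fin m, m - n ≤ (i : ℕ) → m - n ≤ (k : ℕ) → m - n ≤ (j : ℕ) → m - n ≤ (l : ℕ) →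
            M (i, j) (i, j) * M (k, l) (k, l) = M (i, l) (i, l) * M (k, j) (k, j)) →
          M (0, 0) (0, 0) ^ (m - n) * ∏ i ∈ Finset.univ.filter (fun i : Fin m => m - n ≤ (i : ℕ)), M (i, i) (i, i) = 1 →
          ∀ k ≤ m, ∀ D ∈ J k, linSubst (Fin m × Fin m) ℂ Mᵀ D ∈ J k) ∧
        (∀ k ≤ m, ∀ D ∈ J k, apolarAction D (paddedPerPoly ℂ n m) = 0) ∧
        (∀ k ≤ m, ∃ Jk : Submodule ℂ (MvPolynomial (Fin m × Fin m) ℂ),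
          (Jk : Set (MvPolynomial (Fin m × Fin m) ℂ)) = J k ∧
          Jk ≤ MvPolynomial.homogeneousSubmodule (Fin m × Fin m) ℂ k ∧
          Module.finrank ℂ Jk = Nat.choose (m * m + k - 1) k - (Nat.choose m k) ^ 2) ∧
        (∀ k : ℕ, k + 1 ≤ m → ∀ D ∈ J k, ∀ i : Fin m × Fin m, D * MvPolynomial.X i ∈ J (k + 1)) ∧
        (∀ k ≤ m, Nat.choose (m * m + k - 1) k < Nat.choose (m * m - n * n - 2 + k) k + (Nat.choose m k) ^ 2 →
          ∀ D ∈ J k, (∀ s ∈ D.support, ∀ v : Fin m × Fin m,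
            ¬ ((m - n ≤ (v.1 : ℕ) ∧ m - n ≤ (v.2 : ℕ)) ∨ v = (0, 0)) → s v = 0) → D = 0)

/-- Normal form N1 from stubs 3 + 4 (proved). -/
theorem exists_limitSubmodule {m : ℕ} {P : ℕ → MvPolynomial (Fin m × Fin m) ℂ}
    {J : ℕ → Set (MvPolynomial (Fin m × Fin m) ℂ)}
    (hW1 : ∀ t : ℕ, P t ∈ glOrbit (Fin m × Fin m) ℂ (detPoly (Fin m) ℂ))
    (hBL : IsBorderApolarLimit m P J) {k : ℕ} (hk : k ≤ m) :
    ∃ Jk : Submodule ℂ (MvPolynomial (Fin m × Fin m) ℂ),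
      (Jk : Set (MvPolynomial (Fin m × Fin m) ℂ)) = J k ∧
      Jk ≤ MvPolynomial.homogeneousSubmodule (Fin m × Fin m) ℂ k ∧
      Module.finrank ℂ Jk = Nat.choose (m * m + k - 1) k - (Nat.choose m k) ^ 2 := by
  classical
  choose A hAcar hAle hAdim using fun t => DrefuteProbe.AnnDim.stub_annSubmodule m k (P t) (hW1 t)
  have hmemA : ∀ {t : ℕ} {E : MvPolynomial (Fin m × Fin m) ℂ},
      E ∈ A t ↔ E ∈ annihilatorOfDegree (P t) k := fun {t E} => by
    rw [← SetLike.mem_coe, hAcar]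
  refine DrefuteProbe.Kuratowski.stub_kuratowskiSubmodule k _ A (J k) hAle hAdim ?_ ?_
  · intro D hD
    obtain ⟨Ds, hDs, hlim⟩ := hBL.exists_tendsto hk hD
    exact ⟨Ds, fun t => hmemA.2 (hDs t), hlim⟩
  · intro D φ Ds hφ hDs hlim
    exact hBL.mem_of_tendsto hk hφ (fun t => hmemA.1 (hDs t)) hlim

/-- **The line reduction, kernel-checked.** `FixedWitnessObstructionQP` follows from the climb alone:
every other stub of `cone-purity-squeeze` is a theorem (above). -/
theorem fixedWitnessObstructionQP_of_climb (hclimb : Climb) : FixedWitnessObstructionQP := by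
  classical
  intro c
  obtain ⟨n₀, hn₀⟩ := hclimb c
  refine ⟨n₀, fun n hn m _ hnm hm => ?_⟩
  intro act rk
  rintro ⟨P, J, hW1, hLi, hLs, hW4, hW5⟩
  have hBL : IsBorderApolarLimit m P J := ⟨hLi, hLs⟩
  refine hn₀ n hn m hnm hm ⟨P, J, hW1, hBL, hW4, hW5, ?_, ?_, ?_⟩
  · intro k hk
    exact exists_limitSubmodule hW1 hBL hk
  · exact DrefuteProbe.stub_limitIdeal m P J hBL
  · intro k hk hbudget D hD hzfree
    obtain ⟨Jk, hcar, hle, hdim⟩ := exists_limitSubmodule hW1 hBL hk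
    have hmem : ∀ {E : MvPolynomial (Fin m × Fin m) ℂ}, E ∈ Jk ↔ E ∈ J k := fun {E} => by
      rw [← SetLike.mem_coe, hcar]
    obtain ⟨hzif, htor⟩ := DrefuteProbe.stub_h0Elementary n m J hW4 k hk
    refine DrefuteProbe.ConePurity.stub_conePurity n m k Jk (fun E hE => ?_) (fun y z hy hz c' E hE => ?_)
      (fun z hz d hd E hE => ?_) hdim hbudget D (hmem.2 hD) hzfree
    · exact (MvPolynomial.mem_homogeneousSubmodule k E).1 (hle hE)
    · exact hmem.2 (hzif y z hy hz c' E (hmem.1 hE))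
    · exact hmem.2 (htor z hz d hd E (hmem.1 hE))

/-- The converse is trivial (the climb's `∃` has more conjuncts), so the climb is EXACTLY the crux. -/
theorem climb_of_fixedWitnessObstructionQP (hX : FixedWitnessObstructionQP) : Climb := by
  intro c
  obtain ⟨n₀, hn₀⟩ := hX c
  refine ⟨n₀, fun n hn m _ hnm hm => ?_⟩
  rintro ⟨P, J, hW1, hBL, hW4, hW5, -, -, -⟩
  exact hn₀ n hn m hnm hm ⟨P, J, hW1, hBL.1, hBL.2, hW4, hW5⟩

/-- **Climb ↔ crux.** -/
theorem climb_iff_fixedWitnessObstructionQP : Climb ↔ FixedWitnessObstructionQP :=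
  ⟨fixedWitnessObstructionQP_of_climb, climb_of_fixedWitnessObstructionQP⟩

end DrefuteProbe.LineReduction

#print axioms DrefuteProbe.LineReduction.climb_iff_fixedWitnessObstructionQP
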